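import Literature.NumberTheory.EllipticCurves.RohrlichNonvanishingCompositeSupportProofs
import Literature.NumberTheory.Sieve.DivisorBound
import HarnessLib

/-!
# Rohrlich's non-vanishing theorem for a general finite set of primes `P` — the first moment over
# families of composite conductor and the theorem for every newform given a coefficient bound

Topic `NumberTheory/EllipticCurves`; continuation of `RohrlichNonvanishingProofs` (rational newforms,
`P = {p}`), `RohrlichNonvanishingCoeffFieldProofs` (arbitrary newforms, `P = {p}`) and
`RohrlichNonvanishingCompositeSupportProofs` (the arithmetic of composite conductors) towards the named
fact `Rohrlich1984_nonvanishing_twists` of `RohrlichNonvanishing` (Rohrlich 1984, Theorem p. 409).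
This file removes the restriction `P = {p}`:

* `Rohrlich1984_of_coeffBound` — for a normalised newform `f ∈ S₂(Γ₀(N))` (any coefficient field)
  with `|aₙ(f)| ≤ C n^θ` for some `θ < 2/3` and *any* finite set `P` of natural numbers none of
  which divides `N`, only finitely many primitive Dirichlet characters `χ` of conductor divisible
  only by primes in `P` have `L(f, χ, 1) = 0` — the conclusion of `Rohrlich1984_nonvanishing_twists`
  with its hypotheses verbatim, plus the coefficient bound;
* `Rohrlich1984_of_ramanujanPetersson` — the same assuming instead the Ramanujan–Petersson bound
  `|aₙ(f)| ≤ d(n) √n` for `f` (via the divisor bound `d(n) ≪ n^{1/12}` of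
  `Literature.NumberTheory.Sieve.DivisorBound`);
* `Rohrlich1984_nonvanishing_twists_of_ramanujanPetersson`,
  `Rohrlich1984_nonvanishing_twists_of_coeffBound` — hence **the named fact
  `Rohrlich1984_nonvanishing_twists` follows from the Ramanujan–Petersson bound for weight-`2`
  newforms** (Eichler 1954, Shimura 1958, Igusa 1959; Deligne 1974, Thm. 8.2), the one input of
  Rohrlich's paper that the tree does not have (D-0026: not introduced here as a named fact);
* `Rohrlich1984_of_isNewformOf` — **unconditionally for the newform of an elliptic curve `E/ℚ` and
  every finite `P`** (Hasse's bound), the title application of Rohrlich's paper;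
* `Rohrlich1984_of_coeffBound'`, `Rohrlich1984_nonvanishing_twists_of_coeffBound'` — the same with
  the coefficient bound weakened to **any power saving `|aₙ(f)| ≤ C n^θ`, `θ < 1`**: the dual term
  of the first moment is estimated through Rankin's mean square `∑_{n ≤ x} |bₙ|² ≪ x²` of the dual
  form (`tsum_norm_mul_exp_div_le`, `norm_dampedTwist_dual_le_of_card_support_of_summable`,
  `exists_forall_family_exists_twistedSymbolSum_ne_zero_mod'`), so that a pointwise bound is needed
  only with some `θ < 1` (at the sparse integers of the support of the family sum). The named fact
  thus follows already from the classical estimates of Kloosterman (1927) / Rankin (1939) for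
  weight `2`, none of which is in the tree either.

## The argument (Rohrlich 1984, §§1–4, for a composite `P`-smooth conductor `M`)

Let `ψ` be an exceptional primitive character of conductor `M`, `M` divisible only by the primes
`P' ⊆ P`, so `∑_a ψ̄(a){∞, a/M}_f = 0` (Birch). With `n = [K_f : ℚ]` and the step
`r = ∏_{q ∈ P'} q^{v_q(n!)+2} ∏_{q ∈ P'} (q - 1)`:

1. *Galois step* (`twistedSymbolSum_pow_eq_zero_of_modEq_one_step`): the symbol sums of all
   `ψ̄^{1+rj}` vanish, `1 + rj` being an `n!`-th power modulo `φ(M)` and odd.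
2. *The family* `X = ψ⟨ψ^r⟩ = {ψ^{1+rj}}` consists of primitive characters
   (`isPrimitive_pow_of_coprime_orderOf`) of the parity of `ψ`; its character sum is supported on
   `{z : ψ(z)^r = 1}`, a set of at most `4 r ∏_{q ∈ P'} q` classes (`card_filter_apply_pow_eq_one_le`)
   contained in `{z : z^r = 1}` (`pow_eq_one_of_apply_pow_eq_one`), so containing no integer
   `2 ≤ n < M^{1/r}`.
3. *First moment* (`sum_family_twistedSymbolSum_eq_of_coprime`,
   `norm_dampedTwist_sum_sub_le_of_card_support`, `norm_dampedTwist_dual_le_of_card_support`, with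
   the Kloosterman bound `|S(1, b; M)| ≤ (∏_{q ∈ P'} 4q) M^{1/2}` of `norm_kloostermanSum_one_le_sqrt`):
   with `Y = M^{-a}`, `3/2 < a < 1/θ`, the moment `∑_{χ ∈ X} (τ(χ)/M) ∑_a χ̄(a){∞, a/M}_f` equals
   `ε #X (e^{-2πY} + O(M^{(θ-1)/r} + M^{θ-1} + M^{aθ-1} + M^{-1/2} + M^{(2-a)θ'-1/2}))`, non-zero for
   `M ≥ M₀(f, P)` (`exists_forall_family_exists_twistedSymbolSum_ne_zero_mod`) — contradiction.
4. So the exceptional conductors are bounded, and the exceptional characters finite in number.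

## Main statements

* `sum_mul_gaussSum_sq_eq_sum_kloosterman_mod`, `norm_sum_mul_gaussSum_sq_le_of_card_support`,
  `sum_family_twistedSymbolSum_eq_of_coprime`, `norm_dampedTwist_sum_sub_le_of_card_support`,
  `norm_dampedTwist_dual_le_of_card_support`, `exists_forall_family_exists_twistedSymbolSum_ne_zero_mod`
  (the first-moment method for families to a general modulus);
* `finite_exceptional_of_forall_family` (the algebraic half: finiteness of the exceptional set
  given the analytic family statement), `Rohrlich1984_of_coeffBound`, `Rohrlich1984_of_coeffBound'`,
  `Rohrlich1984_of_ramanujanPetersson`, `Rohrlich1984_of_isNewformOf`,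
  `Rohrlich1984_nonvanishing_twists_of_ramanujanPetersson`,
  `Rohrlich1984_nonvanishing_twists_of_coeffBound`, `Rohrlich1984_nonvanishing_twists_of_coeffBound'`.

## References

* D. E. Rohrlich, *On `L`-functions of elliptic curves and cyclotomic towers*, Invent. Math. 75
  (1984), 409–423: Theorem (p. 409), §§1–4.
* G. Shimura, *On the periods of modular forms*, Math. Ann. 229 (1977), 211–221, Thm. 1.
* P. Deligne, *La conjecture de Weil. I*, Publ. Math. IHÉS 43 (1974), Thm. 8.2 (the coefficient
  bound assumed in `Rohrlich1984_of_ramanujanPetersson`).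
* R. A. Rankin, *Modular forms and functions*, CUP 1977, Thm. 4.5.2 (iii) (mean square).
* G. H. Hardy, E. M. Wright, *An Introduction to the Theory of Numbers*, 6th ed., Thm. 315.
* H. Iwaniec, E. Kowalski, *Analytic Number Theory*, AMS Colloq. Publ. 53 (2004), (1.59), §12.3.
-/

noncomputable section

open scoped BigOperators Real
open Finset

namespace Literature.NumberTheory.EllipticCurves

/-! ### The Gauss-sum average over a family of characters to a general modulus -/

section FamilyGeneral

open LFunctions

/-- **The Gauss-sum average over a family is a short sum of Kloosterman sums** (any modulus `M`):
for a unit `y` mod `M` and a finite family `X` of Dirichlet characters mod `M`,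
`∑_{χ ∈ X} χ(y) τ(χ)² = ∑_{h} A(h) · S(1, y⁻¹h; M)`, `A(h) = ∑_{χ ∈ X} χ(h)`, `h` over the support
of `A` (verbatim the computation of `sum_mul_gaussSum_sq_eq_sum_kloosterman` for `M = p^m`).
[folklore] -/
theorem sum_mul_gaussSum_sq_eq_sum_kloosterman_mod {M : ℕ} [NeZero M]
    (X : Finset (DirichletCharacter ℂ M)) {y : ZMod M} (hy : IsUnit y) :
    ∑ χ ∈ X, χ y * gaussSum χ (ZMod.stdAddChar (N := M)) ^ 2 =
      ∑ h ∈ Finset.univ.filter (fun z : ZMod M ↦ ∑ χ ∈ X, χ z ≠ 0),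
        (∑ χ ∈ X, χ h) * kloostermanSum M 1 (h * y⁻¹) := by
  classical
  set A : ZMod M → ℂ := fun z ↦ ∑ χ ∈ X, χ z with hA
  set e : ZMod M → ℂ := fun a ↦ (ZMod.stdAddChar a : ℂ) with he
  have h1 : ∑ χ ∈ X, χ y * gaussSum χ (ZMod.stdAddChar (N := M)) ^ 2 =
      ∑ a : ZMod M, ∑ b : ZMod M, e a * e b * A (y * a * b) := by
    have : ∀ χ ∈ X, χ y * gaussSum χ (ZMod.stdAddChar (N := M)) ^ 2 =
        ∑ a : ZMod M, ∑ b : ZMod M, e a * e b * χ (y * a * b) := by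
      intro χ _
      rw [gaussSum, sq, Finset.sum_mul_sum, Finset.mul_sum]
      refine Finset.sum_congr rfl fun a _ ↦ ?_
      rw [Finset.mul_sum]
      refine Finset.sum_congr rfl fun b _ ↦ ?_
      rw [map_mul, map_mul, he]
      ring
    rw [Finset.sum_congr rfl this, Finset.sum_comm]
    refine Finset.sum_congr rfl fun a _ ↦ ?_
    rw [Finset.sum_comm]
    refine Finset.sum_congr rfl fun b _ ↦ ?_
    rw [hA, Finset.mul_sum]
  have h2 : ∀ z : ZMod M, A z = ∑ h ∈ Finset.univ.filter (fun z : ZMod M ↦ A z ≠ 0),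
      if z = h then A h else 0 := by
    intro z
    rw [Finset.sum_ite_eq]
    by_cases hz : A z = 0
    · rw [if_neg (by simp [hz]), hz]
    · rw [if_pos (by simp [hz])]
  have hyinv : y⁻¹ * y = 1 := ZMod.inv_mul_of_unit y hy
  have hyy : y * y⁻¹ = 1 := ZMod.mul_inv_of_unit y hy
  have h3 : ∀ h : ZMod M, A h ≠ 0 →
      ∑ a : ZMod M, ∑ b : ZMod M, (if y * a * b = h then e a * e b else 0) =
        kloostermanSum M 1 (h * y⁻¹) := by
    intro h hh
    have hhu : IsUnit h := by
      by_contra hnu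
      exact hh (sum_apply_eq_zero_of_not_isUnit X hnu)
    have hyu : IsUnit y⁻¹ := by
      rw [← IsUnit.unit_spec hy, ZMod.inv_coe_unit]; exact Units.isUnit _
    have hcu : IsUnit (h * y⁻¹) := hhu.mul hyu
    rw [kloostermanSum]
    refine Finset.sum_congr rfl fun a _ ↦ ?_
    have hiff : ∀ b : ZMod M, (y * a * b = h) ↔ (a * b = h * y⁻¹) := by
      intro b
      constructor
      · intro hab; rw [← hab]; linear_combination (-(a * b)) * hyinv
      · intro hab
        calc y * a * b = y * (a * b) := by ring
          _ = h := by rw [hab]; linear_combination h * hyy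
    simp_rw [hiff]
    rw [sum_ite_mul_eq hcu (fun b ↦ e a * e b) a]
    by_cases ha : IsUnit a
    · rw [if_pos ha, if_pos ha, he]
      dsimp only
      rw [← AddChar.map_add_eq_mul, one_mul]
    · rw [if_neg ha, if_neg ha]
  rw [h1]
  calc ∑ a : ZMod M, ∑ b : ZMod M, e a * e b * A (y * a * b)
      = ∑ a : ZMod M, ∑ b : ZMod M,
          ∑ h ∈ Finset.univ.filter (fun z : ZMod M ↦ A z ≠ 0),
            A h * (if y * a * b = h then e a * e b else 0) := by
        refine Finset.sum_congr rfl fun a _ ↦ Finset.sum_congr rfl fun b _ ↦ ?_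
        rw [h2 (y * a * b), Finset.mul_sum]
        refine Finset.sum_congr rfl fun h _ ↦ ?_
        split_ifs <;> ring
    _ = ∑ a : ZMod M, ∑ h ∈ Finset.univ.filter (fun z : ZMod M ↦ A z ≠ 0),
          ∑ b : ZMod M, A h * (if y * a * b = h then e a * e b else 0) :=
        Finset.sum_congr rfl fun a _ ↦ Finset.sum_comm
    _ = ∑ h ∈ Finset.univ.filter (fun z : ZMod M ↦ A z ≠ 0), ∑ a : ZMod M,
          ∑ b : ZMod M, A h * (if y * a * b = h then e a * e b else 0) := Finset.sum_comm
    _ = ∑ h ∈ Finset.univ.filter (fun z : ZMod M ↦ A z ≠ 0),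
          A h * ∑ a : ZMod M, ∑ b : ZMod M, (if y * a * b = h then e a * e b else 0) := by
        refine Finset.sum_congr rfl fun h _ ↦ ?_
        rw [Finset.mul_sum]
        exact Finset.sum_congr rfl fun a _ ↦ by rw [Finset.mul_sum]
    _ = _ := by
        refine Finset.sum_congr rfl fun h hh ↦ ?_
        rw [h3 h (Finset.mem_filter.mp hh).2]

/-- **The Gauss-sum average bound for a sparse family, any modulus**: if the character sum of `X`
is supported on at most `R₁` classes and `|S(1, b; M)| ≤ K_M` for all `b`, then
`‖∑_{χ ∈ X} χ(y) τ(χ)²‖ ≤ R₁ · #X · K_M` for every unit `y`. [folklore] -/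
theorem norm_sum_mul_gaussSum_sq_le_of_card_support {M : ℕ} [NeZero M]
    (X : Finset (DirichletCharacter ℂ M)) {R₁ : ℕ}
    (hR : (Finset.univ.filter fun z : ZMod M ↦ ∑ χ ∈ X, χ z ≠ 0).card ≤ R₁)
    {KM : ℝ} (hK : ∀ b : ZMod M, ‖kloostermanSum M 1 b‖ ≤ KM)
    {y : ZMod M} (hy : IsUnit y) :
    ‖∑ χ ∈ X, χ y * gaussSum χ (ZMod.stdAddChar (N := M)) ^ 2‖ ≤ R₁ * (X.card * KM) := by
  classical
  have hKM : 0 ≤ KM := (norm_nonneg _).trans (hK 0)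
  rw [sum_mul_gaussSum_sq_eq_sum_kloosterman_mod X hy]
  refine (norm_sum_le _ _).trans ?_
  calc ∑ h ∈ Finset.univ.filter (fun z : ZMod M ↦ ∑ χ ∈ X, χ z ≠ 0),
        ‖(∑ χ ∈ X, χ h) * kloostermanSum M 1 (h * y⁻¹)‖
      ≤ ∑ h ∈ Finset.univ.filter (fun z : ZMod M ↦ ∑ χ ∈ X, χ z ≠ 0), X.card * KM := by
        refine Finset.sum_le_sum fun h _ ↦ ?_
        rw [norm_mul]
        exact mul_le_mul (norm_sum_apply_le_card X h) (hK _) (norm_nonneg _) (Nat.cast_nonneg _)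
    _ ≤ _ := by
        rw [Finset.sum_const, nsmul_eq_mul]
        exact mul_le_mul_of_nonneg_right (by exact_mod_cast hR)
          (mul_nonneg (Nat.cast_nonneg _) hKM)

end FamilyGeneral

/-! ### The first moment over a family of primitive characters to a general modulus -/

section MomentGeneral

open ModularForms UpperHalfPlane

variable {N : ℕ} [NeZero N] (f : CuspForm (CongruenceSubgroup.Gamma0 N) 2)

/-- **The first-moment identity over a family, any modulus `M` prime to `N`.** For a Fricke pair
`(f, g)` on `Γ₀(N)`, `(M, N) = 1`, `Y > 0`, `Y' = 1/(N M² Y)`, and a finite family `X` of primitive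
characters mod `M` of constant parity `ε`:
`∑_{χ ∈ X} (τ(χ)/M) ∑_a χ̄(a){∞, a/M}_f = ε · (D_f(A, Y) - (1/M) D_g(B, Y'))`,
`A(n) = ∑_χ χ(n)`, `B(n) = ∑_χ χ(N) τ(χ)² χ̄(n)` (as `sum_family_twistedSymbolSum_eq` for `M = p^m`;
Rohrlich 1984, §§2–3). [folklore] -/
theorem sum_family_twistedSymbolSum_eq_of_coprime {g : CuspForm (CongruenceSubgroup.Gamma0 N) 2}
    (hW : IsFrickePair N f g) {M : ℕ} [NeZero M] (hMN : M.Coprime N)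
    (X : Finset (DirichletCharacter ℂ M)) {ε : ℂ}
    (hX : ∀ χ ∈ X, χ.IsPrimitive ∧ χ (-1) = ε) {Y : ℝ} (hY : 0 < Y) :
    ∑ χ ∈ X, gaussSum χ (ZMod.stdAddChar (N := M)) / (M : ℂ) * twistedSymbolSum f χ⁻¹ =
      ε * (dampedTwist f (fun n ↦ ∑ χ ∈ X, χ n) Y -
        1 / (M : ℂ) * dampedTwist g (fun n ↦ ∑ χ ∈ X,
          χ N * gaussSum χ (ZMod.stdAddChar (N := M)) ^ 2 * χ⁻¹ n)
            (1 / ((N : ℝ) * (M : ℕ) ^ 2 * Y))) := by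
  have hY' : 0 < 1 / ((N : ℝ) * (M : ℕ) ^ 2 * Y) := by
    have : (0 : ℝ) < N := Nat.cast_pos.mpr (NeZero.pos N)
    have : (0 : ℝ) < (M : ℕ) := Nat.cast_pos.mpr (NeZero.pos _)
    positivity
  have hM0 : ((M : ℕ) : ℂ) ≠ 0 := Nat.cast_ne_zero.mpr (NeZero.ne _)
  have hterm : ∀ χ ∈ X,
      gaussSum χ (ZMod.stdAddChar (N := M)) / (M : ℂ) * twistedSymbolSum f χ⁻¹ =
        ε * ((1 : ℂ) * dampedTwist f (fun n ↦ χ n) Y) -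
          ε * (1 / (M : ℂ) * ((χ N * gaussSum χ (ZMod.stdAddChar (N := M)) ^ 2) *
            dampedTwist g (fun n ↦ χ⁻¹ n) (1 / ((N : ℝ) * (M : ℕ) ^ 2 * Y)))) := by
    intro χ hχ
    obtain ⟨hprim, hpar⟩ := hX χ hχ
    have h := twistedSymbolSum_inv_eq_dampedTwist_of_isFrickePair f g hW hMN hprim hY
    have hgg := Literature.NumberTheory.Sieve.LargeSieve.gaussSum_mul_gaussSum_inv hprim
    have h1 : χ⁻¹ (-1) = ε := by
      rw [MulChar.inv_apply_eq_inv', hpar]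
      rcases apply_neg_one_eq_one_or χ with h' | h'
      · rw [← hpar, h', inv_one]
      · rw [← hpar, h', inv_neg, inv_one]
    rw [hpar] at hgg
    rw [h, h1]
    field_simp
    linear_combination dampedTwist f (fun n ↦ χ n) Y * hgg
  rw [Finset.sum_congr rfl hterm, Finset.sum_sub_distrib]
  have hA : ∑ χ ∈ X, ε * ((1 : ℂ) * dampedTwist f (fun n ↦ χ n) Y) =
      ε * dampedTwist f (fun n ↦ ∑ χ ∈ X, χ n) Y := by
    rw [← Finset.mul_sum, sum_mul_dampedTwist f X (fun _ ↦ (1 : ℂ))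
      (fun (χ : DirichletCharacter ℂ M) (n : ℕ) ↦ χ n) (B := 1)
      (fun χ n ↦ DirichletCharacter.norm_le_one χ _) hY]
    simp
  have hB : ∑ χ ∈ X, ε * (1 / (M : ℂ) * ((χ N * gaussSum χ (ZMod.stdAddChar (N := M)) ^ 2) *
      dampedTwist g (fun n ↦ χ⁻¹ n) (1 / ((N : ℝ) * (M : ℕ) ^ 2 * Y)))) =
      ε * (1 / (M : ℂ) * dampedTwist g (fun n ↦ ∑ χ ∈ X,
          χ N * gaussSum χ (ZMod.stdAddChar (N := M)) ^ 2 * χ⁻¹ n)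
            (1 / ((N : ℝ) * (M : ℕ) ^ 2 * Y))) := by
    rw [← Finset.mul_sum, ← Finset.mul_sum, sum_mul_dampedTwist g X _
      (fun (χ : DirichletCharacter ℂ M) (n : ℕ) ↦ χ⁻¹ n) (B := 1)
      (fun χ n ↦ DirichletCharacter.norm_le_one χ⁻¹ _) hY']
  rw [hA, hB, mul_sub]

end MomentGeneral

/-! ### The two error terms for a sparse family to a general modulus -/

section ErrorsGeneral

open ModularForms UpperHalfPlane LFunctions

/-- `χ(N) τ(χ)² χ̄(n) = χ(N n̄⁻¹) τ(χ)²` for a unit `n̄ = n mod M` (any modulus; `mul_inv_apply_eq`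
is the case `M = p^m`). [folklore] -/
theorem mul_inv_apply_eq_mod {M : ℕ} [NeZero M] (χ : DirichletCharacter ℂ M) (a : ZMod M)
    {x : ZMod M} (hx : IsUnit x) : χ a * χ⁻¹ x = χ (a * x⁻¹) := by
  rw [map_mul, MulChar.inv_apply, ← hx.unit_spec, Ring.inverse_unit, ZMod.inv_coe_unit]

variable {N : ℕ} [NeZero N] (f : CuspForm (CongruenceSubgroup.Gamma0 N) 2)

omit [NeZero N] in
/-- **The main-term error for a sparse family, any modulus.** For `f` with `a₁ = 1`,
`|aₙ| ≤ C n^θ` (`0 < θ ≤ 1`), `Y > 0`, and a family `X` of characters mod `M` whose character sum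
`A = ∑_{χ ∈ X} χ` is supported on at most `R₁` classes, all inside `{z : z^L = 1}` (`L ≥ 1`):
`‖D_f(A, Y) - #X e^{-2πY}‖ ≤ #X · C · R₁ · ((M^{1/L})^{θ-1} + M^{θ-1}(1 + Γ(θ)(2πYM)^{-θ}))` — the
integers `n ≥ 2` in the support satisfy `n ≥ M^{1/L}` and each block of length `M` contains at
most `R₁` of them (as `norm_dampedTwist_sum_sub_le_of_support` for `M = p^m`). [folklore] -/
theorem norm_dampedTwist_sum_sub_le_of_card_support {M : ℕ} [NeZero M]
    (X : Finset (DirichletCharacter ℂ M)) {R₁ : ℕ}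
    (hR : (Finset.univ.filter fun z : ZMod M ↦ ∑ χ ∈ X, χ z ≠ 0).card ≤ R₁)
    {L : ℕ} (hL : 0 < L) (hsupp : ∀ z : ZMod M, ∑ χ ∈ X, χ z ≠ 0 → z ^ L = 1)
    {C θ : ℝ} (hC : 0 ≤ C) (hθ : 0 < θ) (hθ1 : θ ≤ 1)
    (ha : ∀ n : ℕ, ‖cuspCoeff f n‖ ≤ C * (n : ℝ) ^ θ) (h1 : cuspCoeff f 1 = 1) {Y : ℝ} (hY : 0 < Y) :
    ‖dampedTwist f (fun n ↦ ∑ χ ∈ X, χ n) Y - X.card * (Real.exp (-(2 * Real.pi) * Y) : ℝ)‖ ≤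
      X.card * (C * (R₁ *
        ((((M : ℕ) : ℝ) ^ (1 / L : ℝ)) ^ (θ - 1) +
          ((M : ℕ) : ℝ) ^ (θ - 1) *
            (1 + Real.Gamma θ * (2 * Real.pi * Y * (M : ℕ)) ^ (-θ))))) := by
  classical
  have hM0 : 0 < M := NeZero.pos M
  set A : ℕ → ℂ := fun n ↦ ∑ χ ∈ X, χ n with hA
  set c : ℝ := 2 * Real.pi * Y with hc
  have hcpos : 0 < c := by positivity
  set term : ℕ → ℂ := fun n ↦ A n * cuspCoeff f n * (Real.exp (-(2 * Real.pi * n) * Y) / n : ℝ)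
    with hterm
  have hAle : ∀ n : ℕ, ‖A n‖ ≤ X.card := fun n ↦ norm_sum_apply_le_card X _
  have hsum : Summable term := summable_dampedTwist f hAle hY
  -- the term `n = 1`
  have hA1 : A 1 = X.card := by simp [hA]
  have ht1 : term 1 = X.card * (Real.exp (-(2 * Real.pi) * Y) : ℝ) := by
    simp only [hterm, hA1, h1, Nat.cast_one, mul_one, div_one]
  have hsplit : dampedTwist f (fun n ↦ ∑ χ ∈ X, χ n) Y -
      X.card * (Real.exp (-(2 * Real.pi) * Y) : ℝ) = ∑' n : ℕ, if n = 1 then 0 else term n := by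
    rw [dampedTwist, show (fun n : ℕ ↦ (∑ χ ∈ X, χ (n : ZMod M)) * cuspCoeff f n *
      (Real.exp (-(2 * Real.pi * n) * Y) / n : ℝ)) = term from rfl, hsum.tsum_eq_add_tsum_ite 1, ht1]
    ring
  -- the sparse set `S` of the support and the majorant
  set S : ℕ → Prop := fun n ↦ A n ≠ 0 with hS
  set R : Finset (ZMod M) := Finset.univ.filter fun z : ZMod M ↦ ∑ χ ∈ X, χ z ≠ 0 with hRdef
  have hS₁ : ∀ n, S n → ((n : ℕ) : ZMod M) ∈ R := fun n hn ↦ by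
    rw [hRdef, Finset.mem_filter]; exact ⟨Finset.mem_univ _, hn⟩
  set n₀ : ℝ := ((M : ℕ) : ℝ) ^ (1 / L : ℝ) with hn₀def
  have hn₀ : 0 < n₀ := by positivity
  have hS₂ : ∀ n, S n → 2 ≤ n → n₀ ≤ n := fun n hn hn2 ↦
    rpow_inv_le_of_pow_natCast_eq_one hL hn2 (hsupp _ hn)
  set g : ℕ → ℝ := fun n ↦ X.card * (C *
    (if S n ∧ 2 ≤ n then (n : ℝ) ^ (θ - 1) * Real.exp (-c * n) else 0)) with hg
  have hg0 : ∀ n, 0 ≤ g n := fun n ↦ by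
    simp only [hg]; split_ifs <;> positivity
  have hg_le : ∀ n, g n ≤ X.card * (C * ((n : ℝ) ^ (θ - 1) * Real.exp (-c * n))) := fun n ↦ by
    simp only [hg]
    split_ifs
    · exact le_rfl
    · rw [mul_zero, mul_zero]; positivity
  have hg_summable : Summable g :=
    Summable.of_nonneg_of_le hg0 hg_le (((summable_rpow_mul_exp hθ1 hcpos).mul_left C).mul_left _)
  -- pointwise comparison
  have hpt : ∀ n : ℕ, ‖(if n = 1 then (0 : ℂ) else term n)‖ ≤ g n := by
    intro n
    by_cases hn1 : n = 1
    · rw [if_pos hn1, norm_zero]; exact hg0 n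
    rw [if_neg hn1]
    rcases Nat.eq_zero_or_pos n with rfl | hnpos
    · simp only [hterm, Nat.cast_zero, div_zero, Complex.ofReal_zero, mul_zero, norm_zero]
      exact hg0 0
    have hn2 : 2 ≤ n := by omega
    by_cases hAn : A n = 0
    · simp only [hterm, hAn, zero_mul, norm_zero]; exact hg0 n
    have hSn : S n := hAn
    have hgn : g n = X.card * (C * ((n : ℝ) ^ (θ - 1) * Real.exp (-c * n))) := by
      simp only [hg, if_pos (And.intro hSn hn2)]
    rw [hgn, hterm]
    dsimp only
    rw [norm_mul, norm_mul, Complex.norm_real, Real.norm_of_nonneg (by positivity)]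
    have hnr : (0 : ℝ) < n := Nat.cast_pos.mpr hnpos
    calc ‖A n‖ * ‖cuspCoeff f n‖ * (Real.exp (-(2 * Real.pi * n) * Y) / n)
        ≤ X.card * (C * (n : ℝ) ^ θ) * (Real.exp (-(2 * Real.pi * n) * Y) / n) := by
          gcongr
          · exact hAle n
          · exact ha n
      _ = X.card * (C * ((n : ℝ) ^ (θ - 1) * Real.exp (-c * n))) := by
          rw [Real.rpow_sub_one hnr.ne', hc]
          field_simp
  -- partial sums of the majorant
  have hE0 : 0 ≤ n₀ ^ (θ - 1) + ((M : ℕ) : ℝ) ^ (θ - 1) * (1 + Real.Gamma θ * (c * M) ^ (-θ)) := by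
    have := Real.Gamma_pos_of_pos hθ; positivity
  have hpartial : ∀ M' : ℕ, ∑ n ∈ Finset.range M', g n ≤ X.card * (C * (R₁ *
      (n₀ ^ (θ - 1) + ((M : ℕ) : ℝ) ^ (θ - 1) * (1 + Real.Gamma θ * (c * M) ^ (-θ))))) := by
    intro M'
    simp only [hg, ← Finset.mul_sum]
    refine mul_le_mul_of_nonneg_left (mul_le_mul_of_nonneg_left ?_ hC) (Nat.cast_nonneg _)
    have h := sum_range_indicator_rpow_mul_exp_le hθ hθ1 hcpos hM0 R hn₀ S hS₁ hS₂ M'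
    refine h.trans ?_
    have hR' : ((R.card : ℕ) : ℝ) ≤ ((R₁ : ℕ) : ℝ) := by exact_mod_cast hR
    exact mul_le_mul_of_nonneg_right hR' hE0
  -- conclusion
  rw [hsplit]
  refine (tsum_of_norm_bounded hg_summable.hasSum hpt).trans ?_
  refine (Real.tsum_le_of_sum_range_le hg0 hpartial).trans (le_of_eq ?_)
  rw [hn₀def, hc]

omit [NeZero N] in
/-- **The dual-term error for a sparse family, any modulus.** For a cusp form `f ∈ S_2(Γ₀(N))`
(below: the dual form `g = w_N f`) with `|aₙ| ≤ C n^θ` (`0 < θ ≤ 1`), `(M, N) = 1`, `Y' > 0`, a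
family `X` of characters mod `M` with character sum supported on at most `R₁` classes, and a
Kloosterman bound `|S(1, b; M)| ≤ K_M`:
`‖D_f(B, Y')‖ ≤ #X · C · (R₁ K_M) · (1 + Γ(θ)(2πY')^{-θ})`, `B(n) = ∑_{χ ∈ X} χ(N) τ(χ)² χ̄(n)`
(as `norm_dampedTwist_dual_le_of_support` for `M = p^m`). [folklore] -/
theorem norm_dampedTwist_dual_le_of_card_support {M : ℕ} [NeZero M] (hMN : M.Coprime N)
    (X : Finset (DirichletCharacter ℂ M)) {R₁ : ℕ}
    (hR : (Finset.univ.filter fun z : ZMod M ↦ ∑ χ ∈ X, χ z ≠ 0).card ≤ R₁)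
    {KM : ℝ} (hK : ∀ b : ZMod M, ‖kloostermanSum M 1 b‖ ≤ KM)
    {C θ : ℝ} (hC : 0 ≤ C) (hθ : 0 < θ) (hθ1 : θ ≤ 1)
    (ha : ∀ n : ℕ, ‖cuspCoeff f n‖ ≤ C * (n : ℝ) ^ θ) {Y' : ℝ} (hY' : 0 < Y') :
    ‖dampedTwist f (fun n ↦ ∑ χ ∈ X,
        χ N * gaussSum χ (ZMod.stdAddChar (N := M)) ^ 2 * χ⁻¹ n) Y'‖ ≤
      X.card * (C * ((R₁ * KM) * (1 + Real.Gamma θ * (2 * Real.pi * Y') ^ (-θ)))) := by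
  classical
  have hKM : 0 ≤ KM := (norm_nonneg _).trans (hK 0)
  set β : ℝ := R₁ * KM with hβ
  have hβ0 : 0 ≤ β := by positivity
  set Bw : ℕ → ℂ := fun n ↦ ∑ χ ∈ X, χ N * gaussSum χ (ZMod.stdAddChar (N := M)) ^ 2 * χ⁻¹ n
    with hBw
  set c : ℝ := 2 * Real.pi * Y' with hc
  have hcpos : 0 < c := by positivity
  have hNu : IsUnit ((N : ℕ) : ZMod M) := by
    rw [ZMod.isUnit_iff_coprime]; exact hMN.symm
  -- bound for the weight
  have hBle : ∀ n : ℕ, ‖Bw n‖ ≤ X.card * β := by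
    intro n
    by_cases hn : IsUnit ((n : ℕ) : ZMod M)
    · have : Bw n = ∑ χ ∈ X, χ ((N : ZMod M) * ((n : ℕ) : ZMod M)⁻¹) *
          gaussSum χ (ZMod.stdAddChar (N := M)) ^ 2 := by
        refine Finset.sum_congr rfl fun χ _ ↦ ?_
        rw [← mul_inv_apply_eq_mod χ _ hn]; ring
      rw [this]
      have hyu : IsUnit ((N : ZMod M) * ((n : ℕ) : ZMod M)⁻¹) := by
        refine hNu.mul ?_
        rw [← hn.unit_spec, ZMod.inv_coe_unit]; exact Units.isUnit _
      have h := norm_sum_mul_gaussSum_sq_le_of_card_support X hR hK hyu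
      rw [hβ]
      refine h.trans (le_of_eq ?_)
      ring
    · have : Bw n = 0 := Finset.sum_eq_zero fun χ _ ↦ by rw [MulChar.map_nonunit χ⁻¹ hn, mul_zero]
      rw [this, norm_zero]; positivity
  -- the majorant (zero at `n = 0`, where the term vanishes)
  set h : ℕ → ℝ := fun n ↦
    if n = 0 then 0 else X.card * β * C * ((n : ℝ) ^ (θ - 1) * Real.exp (-c * n)) with hh
  have hh0 : ∀ n, 0 ≤ h n := fun n ↦ by
    simp only [hh]; split_ifs <;> positivity
  have hh_le : ∀ n, h n ≤ X.card * β * C * ((n : ℝ) ^ (θ - 1) * Real.exp (-c * n)) := fun n ↦ by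
    simp only [hh]; split_ifs <;> first | positivity | exact le_rfl
  have hh_summable : Summable h :=
    Summable.of_nonneg_of_le hh0 hh_le ((summable_rpow_mul_exp hθ1 hcpos).mul_left _)
  have hpt : ∀ n : ℕ, ‖Bw n * cuspCoeff f n * (Real.exp (-(2 * Real.pi * n) * Y') / n : ℝ)‖ ≤ h n := by
    intro n
    rcases Nat.eq_zero_or_pos n with rfl | hnpos
    · simp only [Nat.cast_zero, div_zero, Complex.ofReal_zero, mul_zero, norm_zero]; exact hh0 0
    have hnr : (0 : ℝ) < n := Nat.cast_pos.mpr hnpos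
    rw [norm_mul, norm_mul, Complex.norm_real, Real.norm_of_nonneg (by positivity), hh]
    dsimp only
    rw [if_neg hnpos.ne']
    calc ‖Bw n‖ * ‖cuspCoeff f n‖ * (Real.exp (-(2 * Real.pi * n) * Y') / n)
        ≤ (X.card * β) * (C * (n : ℝ) ^ θ) * (Real.exp (-(2 * Real.pi * n) * Y') / n) := by
          gcongr
          · exact hBle n
          · exact ha n
      _ = X.card * β * C * ((n : ℝ) ^ (θ - 1) * Real.exp (-c * n)) := by
          rw [Real.rpow_sub_one hnr.ne', hc]
          field_simp
  have htsum : ∑' n, h n ≤ X.card * β * C * (1 + Real.Gamma θ * c ^ (-θ)) := by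
    have h0 : h 0 = 0 := by simp only [hh, if_pos rfl]
    rw [hh_summable.tsum_eq_zero_add, h0, zero_add]
    have h' : ∀ n : ℕ, h (n + 1) = X.card * β * C *
        ((((n + 1 : ℕ) : ℝ)) ^ (θ - 1) * Real.exp (-c * ((n + 1 : ℕ) : ℝ))) := fun n ↦ by
      simp only [hh, if_neg (Nat.succ_ne_zero n)]
    simp only [h']
    rw [tsum_mul_left]
    refine mul_le_mul_of_nonneg_left ?_ (by positivity)
    refine Real.tsum_le_of_sum_range_le (fun n ↦ by positivity) fun M' ↦ ?_
    exact sum_range_rpow_mul_exp_le hθ hθ1 hcpos M'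
  rw [dampedTwist]
  refine (tsum_of_norm_bounded hh_summable.hasSum hpt).trans (htsum.trans (le_of_eq ?_))
  rw [hβ, hc]; ring

end ErrorsGeneral

/-! ### Asymptotics in the conductor: no admissible family of large `P`-smooth conductor is killed -/

section FinalGeneral

open ModularForms UpperHalfPlane LFunctions Filter Topology

variable {N : ℕ} [NeZero N] (f : CuspForm (CongruenceSubgroup.Gamma0 N) 2)

omit [NeZero N] in
/-- `P`-smooth numbers are prime to `N` when no prime of `P` divides `N`. [folklore] -/
theorem coprime_of_primeFactors_subset {P : Finset ℕ} (hPN : ∀ q ∈ P, ¬ q ∣ N) {M : ℕ} (hM : M ≠ 0)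
    (hMP : M.primeFactors ⊆ P) : M.Coprime N :=
  Nat.coprime_of_dvd fun q hq hqM hqN ↦ hPN q (hMP (Nat.mem_primeFactors.mpr ⟨hq, hqM, hM⟩)) hqN

/-- **No admissible family of large `P`-smooth conductor is killed by the symbol sums.** Let
`(f, g)` be a Fricke pair on `Γ₀(N)` with `a₁(f) = 1`, `|aₙ(f)| ≤ C n^θ` (`θ < 2/3`),
`|aₙ(g)| ≤ C' n^{θ'}` (`θ' ≤ 1`), `P` a finite set of primes not dividing `N`, and fix `R₁` and
`L ≥ 1`. There is `M₀` such that for every `P`-smooth `M ≥ M₀` and every non-empty family `X` of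
primitive characters mod `M` of constant parity whose character sum is supported on at most `R₁`
classes inside `{z : z^L = 1}`, some `χ ∈ X` has `∑_a χ̄(a){∞, a/M}_f ≠ 0`. As
`exists_forall_family_exists_twistedSymbolSum_ne_zero` (`M = p^m`): with `Y = M^{-a}`,
`3/2 < a < 1/θ`, the first moment is `ε #X (e^{-2πY} + O(δ_M))`, `δ_M → 0`
(`sum_family_twistedSymbolSum_eq_of_coprime`, `norm_dampedTwist_sum_sub_le_of_card_support`,
`norm_dampedTwist_dual_le_of_card_support` with the Kloosterman bound
`norm_kloostermanSum_one_le_sqrt`); Rohrlich 1984, §§2–4. [folklore] -/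
theorem exists_forall_family_exists_twistedSymbolSum_ne_zero_mod
    {g : CuspForm (CongruenceSubgroup.Gamma0 N) 2} (hW : IsFrickePair N f g)
    {P : Finset ℕ} (hP : ∀ q ∈ P, q.Prime) (hPN : ∀ q ∈ P, ¬ q ∣ N)
    {C θ C' θ' : ℝ} (hC : 0 ≤ C) (hθ : 0 < θ) (hθ1 : θ < 2 / 3) (hC' : 0 ≤ C') (hθ' : 0 < θ')
    (hθ'1 : θ' ≤ 1) (ha : ∀ n : ℕ, ‖cuspCoeff f n‖ ≤ C * (n : ℝ) ^ θ)
    (hb : ∀ n : ℕ, ‖cuspCoeff g n‖ ≤ C' * (n : ℝ) ^ θ') (h1 : cuspCoeff f 1 = 1)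
    (R₁ : ℕ) {L : ℕ} (hL : 0 < L) :
    ∃ M₀ : ℕ, ∀ M : ℕ, M₀ ≤ M → ∀ [NeZero M], M.primeFactors ⊆ P →
      ∀ (X : Finset (DirichletCharacter ℂ M)) (ε : ℂ), X.Nonempty →
      (∀ χ ∈ X, χ.IsPrimitive ∧ χ (-1) = ε) →
      (Finset.univ.filter fun z : ZMod M ↦ ∑ χ ∈ X, χ z ≠ 0).card ≤ R₁ →
      (∀ z : ZMod M, ∑ χ ∈ X, χ z ≠ 0 → z ^ L = 1) →
      ∃ χ ∈ X, twistedSymbolSum f χ⁻¹ ≠ 0 := by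
  have hNr : (0 : ℝ) < N := Nat.cast_pos.mpr (NeZero.pos N)
  have h2π : (0 : ℝ) < 2 * Real.pi := Real.two_pi_pos
  have hLr : (0 : ℝ) < L := Nat.cast_pos.mpr hL
  -- the exponent `a`, `3/2 < a < 1/θ`
  set a : ℝ := 3 / 4 + 1 / (2 * θ) with hadef
  have haθ' : a * θ = 3 / 4 * θ + 1 / 2 := by
    rw [hadef]; field_simp
  have haθ : a * θ - 1 < 0 := by rw [haθ']; linarith
  have ha32 : 3 / 2 < a := by
    have : 3 / 4 < 1 / (2 * θ) := by
      rw [lt_div_iff₀ (by positivity)]; linarith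
    rw [hadef]; linarith
  have ha0 : 0 < a := by linarith
  have hdual : (2 - a) * θ' - 1 / 2 < 0 := by nlinarith [mul_pos (sub_pos.mpr ha32) hθ', hθ'1]
  -- the Kloosterman constant
  set cP : ℝ := ∏ ℓ ∈ P, 4 * (ℓ : ℝ) with hcP
  have hcP0 : 0 ≤ cP := Finset.prod_nonneg fun ℓ _ ↦ by positivity
  -- the parameter `Y = M^{-a}`
  set Y : ℕ → ℝ := fun M ↦ (M : ℝ) ^ (-a) with hYdef
  have hYpos : ∀ M, 0 < M → 0 < Y M := fun M hM ↦
    Real.rpow_pos_of_pos (Nat.cast_pos.mpr hM) _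
  -- the error sequences
  set e₁ : ℝ := (θ - 1) / L with he₁
  set K₃ : ℝ := Real.Gamma θ * (2 * Real.pi) ^ (-θ) with hK₃
  set err₁ : ℕ → ℝ := fun M ↦ C * (R₁ *
    ((M : ℝ) ^ e₁ + ((M : ℝ) ^ (θ - 1) + K₃ * (M : ℝ) ^ (a * θ - 1)))) with herr₁
  set K₄ : ℝ := C' * (R₁ * cP) with hK₄
  set K₅ : ℝ := Real.Gamma θ' * (2 * Real.pi / N) ^ (-θ') with hK₅
  set err₂ : ℕ → ℝ := fun M ↦ K₄ * ((M : ℝ) ^ (-(1 / 2 : ℝ)) + K₅ * (M : ℝ) ^ ((2 - a) * θ' - 1 / 2))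
    with herr₂
  -- limits
  have hXlim : Tendsto (fun M : ℕ ↦ (M : ℝ)) atTop atTop := tendsto_natCast_atTop_atTop
  have hrpow : ∀ {Z : ℕ → ℝ} (_ : Tendsto Z atTop atTop) {e : ℝ} (_ : e < 0),
      Tendsto (fun m ↦ Z m ^ e) atTop (𝓝 0) := by
    intro Z hZ e he
    have h := (tendsto_rpow_neg_atTop (neg_pos.mpr he)).comp hZ
    simp only [neg_neg] at h
    exact h
  have he₁neg : e₁ < 0 := div_neg_of_neg_of_pos (by linarith) hLr
  have herr₁lim : Tendsto err₁ atTop (𝓝 0) := by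
    have h := ((hrpow hXlim he₁neg).add ((hrpow hXlim (by linarith : θ - 1 < 0)).add
      ((hrpow hXlim haθ).const_mul K₃))).const_mul (R₁ : ℝ) |>.const_mul C
    simpa [herr₁] using h
  have herr₂lim : Tendsto err₂ atTop (𝓝 0) := by
    have h := ((hrpow hXlim (by norm_num : -(1 / 2 : ℝ) < 0)).add
      ((hrpow hXlim hdual).const_mul K₅)).const_mul K₄
    simpa [herr₂] using h
  have hexplim : Tendsto (fun M ↦ Real.exp (-(2 * Real.pi) * Y M)) atTop (𝓝 1) := by
    have hY0 : Tendsto Y atTop (𝓝 0) := hrpow hXlim (by linarith : -a < 0)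
    have h0 : Tendsto (fun M ↦ -(2 * Real.pi) * Y M) atTop (𝓝 0) := by
      simpa using hY0.const_mul (-(2 * Real.pi))
    have := (Real.continuous_exp.tendsto 0).comp h0
    rw [Real.exp_zero] at this
    refine this.congr fun M ↦ ?_
    simp only [Function.comp_apply]
  -- choose `M₀`
  have hev : ∀ᶠ M in atTop, err₁ M + err₂ M < 1 / 2 ∧ 1 / 2 < Real.exp (-(2 * Real.pi) * Y M) ∧
      1 ≤ M := by
    refine ((herr₁lim.add herr₂lim).eventually (gt_mem_nhds ?_)).and
      ((hexplim.eventually (lt_mem_nhds ?_)).and (eventually_ge_atTop 1))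
    · norm_num
    · norm_num
  obtain ⟨M₀, hM₀⟩ := eventually_atTop.mp hev
  refine ⟨M₀, fun M hM _ hMP Xf ε hne hXf hR hsupp ↦ ?_⟩
  obtain ⟨hlt, hexp, hM1⟩ := hM₀ M hM
  have hMpos : 0 < M := hM1
  have hMr : (0 : ℝ) < M := Nat.cast_pos.mpr hMpos
  have hMN : M.Coprime N := coprime_of_primeFactors_subset hPN hMpos.ne' hMP
  -- suppose all the twisted symbol sums vanish
  by_contra hall
  push Not at hall
  have hcard : 0 < (Xf.card : ℝ) := by exact_mod_cast Finset.card_pos.mpr hne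
  -- `ε ≠ 0`
  have hε : ε ≠ 0 := by
    obtain ⟨χ, hχ⟩ := hne
    rw [← (hXf χ hχ).2]
    rcases apply_neg_one_eq_one_or χ with h | h
    · rw [h]; exact one_ne_zero
    · rw [h]; exact neg_ne_zero.mpr one_ne_zero
  -- the moment vanishes
  have hmom : ∑ χ ∈ Xf, gaussSum χ (ZMod.stdAddChar (N := M)) / (M : ℂ) *
      twistedSymbolSum f χ⁻¹ = 0 :=
    Finset.sum_eq_zero fun χ hχ ↦ by rw [hall χ hχ, mul_zero]
  rw [sum_family_twistedSymbolSum_eq_of_coprime f hW hMN Xf hXf (hYpos M hMpos)] at hmom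
  replace hmom := (mul_eq_zero.mp hmom).resolve_left hε
  -- the two error bounds at `Y = Y M`
  have hE₁ := norm_dampedTwist_sum_sub_le_of_card_support f Xf hR hL hsupp hC hθ (by linarith)
    ha h1 (hYpos M hMpos)
  have hY'pos : 0 < 1 / ((N : ℝ) * (M : ℕ) ^ 2 * Y M) := by
    have := hYpos M hMpos
    positivity
  have hK : ∀ b : ZMod M, ‖kloostermanSum M 1 b‖ ≤ cP * (M : ℝ) ^ (1 / 2 : ℝ) :=
    norm_kloostermanSum_one_le_sqrt hP hMP
  have hE₂ := norm_dampedTwist_dual_le_of_card_support g hMN Xf hR hK hC' hθ' hθ'1 hb hY'pos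
  -- simplify the error bounds to `#X · err₁ M` and `#X · err₂ M`
  have hA : ((M : ℝ) ^ (1 / L : ℝ)) ^ (θ - 1) = (M : ℝ) ^ e₁ := by
    rw [← Real.rpow_mul hMr.le, he₁]
    congr 1
    field_simp
  have hB : (M : ℝ) ^ (θ - 1) * (1 + Real.Gamma θ * (2 * Real.pi * Y M * (M : ℝ)) ^ (-θ)) =
      (M : ℝ) ^ (θ - 1) + K₃ * (M : ℝ) ^ (a * θ - 1) := by
    rw [hYdef]
    dsimp only
    rw [hK₃]
    have h := main_exponent_eq_offset (θ := θ) (a := a) one_pos hMr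
    rw [one_mul, Real.one_rpow, mul_one] at h
    linear_combination Real.Gamma θ * h
  have hE₁' : ‖dampedTwist f (fun n ↦ ∑ χ ∈ Xf, χ n) (Y M) -
      Xf.card * (Real.exp (-(2 * Real.pi) * Y M) : ℝ)‖ ≤ Xf.card * err₁ M := by
    have h := hE₁
    rw [hA, hB] at h
    simpa only [herr₁] using h
  have hE₂' : ‖(1 / (M : ℂ)) * dampedTwist g (fun n ↦ ∑ χ ∈ Xf,
      χ N * gaussSum χ (ZMod.stdAddChar (N := M)) ^ 2 * χ⁻¹ n) (1 / ((N : ℝ) * (M : ℕ) ^ 2 * Y M))‖ ≤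
      Xf.card * err₂ M := by
    rw [norm_mul, norm_div, norm_one, show ‖(M : ℂ)‖ = (M : ℝ) by
      rw [Complex.norm_natCast]]
    refine (mul_le_mul_of_nonneg_left hE₂ (by positivity)).trans ?_
    have hZ : (2 * Real.pi * (1 / ((N : ℝ) * (M : ℝ) ^ 2 * Y M))) ^ (-θ') =
        (2 * Real.pi / N) ^ (-θ') * (M : ℝ) ^ ((2 - a) * θ') := by
      rw [hYdef]; exact dual_exponent_eq_offset hNr hMr
    have hG : 0 ≤ Real.Gamma θ' := (Real.Gamma_pos_of_pos hθ').le
    have hx1 : (M : ℝ) ^ (1 / 2 : ℝ) / (M : ℝ) = (M : ℝ) ^ (-(1 / 2 : ℝ)) := by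
      rw [div_eq_iff hMr.ne', ← Real.rpow_add_one hMr.ne']
      norm_num
    have hx2 : (M : ℝ) ^ (1 / 2 : ℝ) * (M : ℝ) ^ ((2 - a) * θ') / (M : ℝ) = (M : ℝ) ^ ((2 - a) * θ' - 1 / 2) := by
      rw [div_eq_iff hMr.ne', ← Real.rpow_add hMr, ← Real.rpow_add_one hMr.ne']
      congr 1; ring
    rw [hZ]
    calc 1 / (M : ℝ) * ((Xf.card) * (C' * ((R₁ * (cP * (M : ℝ) ^ (1 / 2 : ℝ))) *
          (1 + Real.Gamma θ' * ((2 * Real.pi / N) ^ (-θ') * (M : ℝ) ^ ((2 - a) * θ'))))))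
        = (Xf.card) * (C' * (R₁ * cP)) *
          ((M : ℝ) ^ (1 / 2 : ℝ) / (M : ℝ) + Real.Gamma θ' * (2 * Real.pi / N) ^ (-θ') *
            ((M : ℝ) ^ (1 / 2 : ℝ) * (M : ℝ) ^ ((2 - a) * θ') / (M : ℝ))) := by
          ring
      _ = (Xf.card) * err₂ M := by
          rw [hx1, hx2]
          simp only [herr₂, hK₄, hK₅]
          ring
      _ ≤ (Xf.card) * err₂ M := le_rfl
  -- the contradiction
  have hkey : (Xf.card : ℝ) * Real.exp (-(2 * Real.pi) * Y M) ≤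
      Xf.card * err₁ M + Xf.card * err₂ M := by
    have hnorm : ‖((Xf.card) * (Real.exp (-(2 * Real.pi) * Y M) : ℝ) : ℂ)‖ =
        (Xf.card : ℝ) * Real.exp (-(2 * Real.pi) * Y M) := by
      rw [show ((Xf.card) * (Real.exp (-(2 * Real.pi) * Y M) : ℝ) : ℂ) =
        (((Xf.card) * Real.exp (-(2 * Real.pi) * Y M) : ℝ) : ℂ) by push_cast; ring,
        Complex.norm_real, Real.norm_of_nonneg (by positivity)]
    rw [← hnorm]
    set D₁ := dampedTwist f (fun n ↦ ∑ χ ∈ Xf, χ n) (Y M)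
    set D₂ := (1 / (M : ℂ)) * dampedTwist g (fun n ↦ ∑ χ ∈ Xf,
      χ N * gaussSum χ (ZMod.stdAddChar (N := M)) ^ 2 * χ⁻¹ n) (1 / ((N : ℝ) * (M : ℕ) ^ 2 * Y M))
    have hD : D₁ = D₂ := sub_eq_zero.mp hmom
    calc ‖((Xf.card) * (Real.exp (-(2 * Real.pi) * Y M) : ℝ) : ℂ)‖
        = ‖((((Xf.card) * (Real.exp (-(2 * Real.pi) * Y M) : ℝ) : ℂ) - D₁) + D₂)‖ := by
          rw [hD, sub_add_cancel]
      _ ≤ ‖((Xf.card) * (Real.exp (-(2 * Real.pi) * Y M) : ℝ) : ℂ) - D₁‖ + ‖D₂‖ :=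
          norm_add_le _ _
      _ ≤ _ := by
          refine add_le_add ?_ hE₂'
          rw [norm_sub_rev]; exact hE₁'
  have : Real.exp (-(2 * Real.pi) * Y M) ≤ err₁ M + err₂ M := by
    have h := hkey
    rw [← mul_add] at h
    exact le_of_mul_le_mul_left h hcard
  linarith

end FinalGeneral

/-! ### Mean-square input for the dual term: `∑ |bₙ| e^{-2πny}/n ≪ y^{-1/2-δ}` -/

section MeanSquare

open Filter Topology

/-- `∑_{1 ≤ n ≤ M'} e^{-vn} ≤ 1/v` for `v > 0` (geometric series and `e^v ≥ 1 + v`). [folklore] -/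
theorem sum_range_exp_neg_mul_succ_le {v : ℝ} (hv : 0 < v) (M' : ℕ) :
    ∑ n ∈ Finset.range M', Real.exp (-v * ((n : ℝ) + 1)) ≤ 1 / v := by
  set r : ℝ := Real.exp (-v) with hr
  have hr0 : 0 ≤ r := (Real.exp_pos _).le
  have hr1 : r < 1 := Real.exp_lt_one_iff.mpr (by linarith)
  have hterm : ∀ n : ℕ, Real.exp (-v * ((n : ℝ) + 1)) = r * r ^ n := fun n ↦ by
    rw [hr, ← pow_succ', ← Real.exp_nat_mul]
    congr 1; push_cast; ring
  simp_rw [hterm]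
  have hgeom : HasSum (fun n : ℕ ↦ r * r ^ n) (r * (1 - r)⁻¹) :=
    (hasSum_geometric_of_lt_one hr0 hr1).mul_left r
  calc ∑ n ∈ Finset.range M', r * r ^ n ≤ r * (1 - r)⁻¹ :=
        sum_le_hasSum _ (fun n _ ↦ by positivity) hgeom
    _ = 1 / (Real.exp v - 1) := by
        have hne : Real.exp v - 1 ≠ 0 := by
          have := Real.add_one_le_exp v; linarith
        have hne' : 1 - r ≠ 0 := by linarith
        rw [hr, Real.exp_neg]
        field_simp
    _ ≤ 1 / v := one_div_le_one_div_of_le hv (by have := Real.add_one_le_exp v; linarith)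

/-- **From the mean square to the damped first moment.** If `∑ ‖bₙ‖² n^{-2-2δ} < ∞`
(`0 < δ ≤ 1/2`), then for every `y > 0`
`∑_{n ≥ 1} ‖bₙ‖ e^{-2πny}/n ≤ (∑ ‖bₙ‖² n^{-2-2δ})^{1/2} · (2πy)^{-(1+2δ)/2}`:
Cauchy–Schwarz with `‖bₙ‖ e^{-2πny}/n = (‖bₙ‖ n^{-1-δ}) · (n^δ e^{-2πny})` and
`∑_{n ≥ 1} n^{2δ} e^{-4πny} ≤ (2πy)^{-2δ} ∑_{n ≥ 1} e^{-2πny} ≤ (2πy)^{-1-2δ}`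
(`u^s e^{-u} ≤ 1` for `s ≤ 1`, `sum_range_exp_neg_mul_succ_le`). For the coefficients of a weight-`2`
cusp form the hypothesis is Rankin's mean-square bound (`sum_Ico_sq_cuspCoeff_le`,
`summable_div_rpow_of_sum_Ico_le`). [folklore] -/
theorem tsum_norm_mul_exp_div_le {b : ℕ → ℂ} {δ : ℝ} (hδ0 : 0 < δ) (hδ1 : δ ≤ 1 / 2)
    (hS : Summable fun n : ℕ ↦ ‖b n‖ ^ 2 / (n : ℝ) ^ (2 + 2 * δ)) {y : ℝ} (hy : 0 < y) :
    ∑' n : ℕ, ‖b n‖ * (Real.exp (-(2 * Real.pi * n) * y) / n) ≤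
      Real.sqrt (∑' n : ℕ, ‖b n‖ ^ 2 / (n : ℝ) ^ (2 + 2 * δ)) *
        (2 * Real.pi * y) ^ (-(1 + 2 * δ) / 2) := by
  set c : ℝ := 2 * Real.pi * y with hc
  have hcpos : 0 < c := by positivity
  set S : ℝ := ∑' n : ℕ, ‖b n‖ ^ 2 / (n : ℝ) ^ (2 + 2 * δ) with hSdef
  have hS0 : 0 ≤ S := tsum_nonneg fun n ↦ by positivity
  -- the two Cauchy–Schwarz factors
  set F : ℕ → ℝ := fun n ↦ ‖b n‖ / (n : ℝ) ^ (1 + δ) with hF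
  set G : ℕ → ℝ := fun n ↦ (n : ℝ) ^ δ * Real.exp (-c * n) with hG
  have hterm : ∀ n : ℕ, ‖b n‖ * (Real.exp (-(2 * Real.pi * n) * y) / n) = F n * G n := by
    intro n
    rcases Nat.eq_zero_or_pos n with rfl | hn
    · simp [hF, hG, Real.zero_rpow hδ0.ne']
    have hnr : (0 : ℝ) < n := Nat.cast_pos.mpr hn
    have h1 : (n : ℝ) ^ (1 + δ) = n * (n : ℝ) ^ δ := by
      rw [Real.rpow_add hnr, Real.rpow_one]
    have h2 : Real.exp (-(2 * Real.pi * n) * y) = Real.exp (-c * n) := by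
      rw [hc]; congr 1; ring
    simp only [hF, hG]
    rw [h1, h2]
    have hnδ : (0 : ℝ) < (n : ℝ) ^ δ := Real.rpow_pos_of_pos hnr δ
    field_simp
  have hF2 : ∀ n : ℕ, F n ^ 2 = ‖b n‖ ^ 2 / (n : ℝ) ^ (2 + 2 * δ) := by
    intro n
    rw [hF]
    dsimp only
    rw [div_pow, ← Real.rpow_natCast ((n : ℝ) ^ (1 + δ)) 2, ← Real.rpow_mul (Nat.cast_nonneg n)]
    congr 2
    push_cast; ring
  have hG2 : ∀ n : ℕ, G n ^ 2 ≤ c ^ (-(2 * δ)) * Real.exp (-c * n) := by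
    intro n
    have hn0 : (0 : ℝ) ≤ n := Nat.cast_nonneg n
    have hcn : 0 ≤ c * n := by positivity
    -- `u^s e^{-u} ≤ 1` for `u = c n ≥ 0`, `s = 2δ ∈ [0, 1]` (`u^s ≤ max(1, u) ≤ e^u`; cf.
    -- `Literature.Analysis.FluidPDE.rpow_mul_exp_neg_le_one`)
    have key : (c * n) ^ (2 * δ) * Real.exp (-(c * n)) ≤ 1 := by
      have hexp1 : Real.exp (-(c * n)) ≤ 1 := Real.exp_le_one_iff.mpr (by linarith)
      rcases le_or_gt (c * n) 1 with hle | hgt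
      · calc (c * n) ^ (2 * δ) * Real.exp (-(c * n)) ≤ 1 * 1 :=
              mul_le_mul (Real.rpow_le_one hcn hle (by linarith)) hexp1 (Real.exp_pos _).le
                zero_le_one
          _ = 1 := one_mul _
      · have hus : (c * n) ^ (2 * δ) ≤ c * n := by
          calc (c * n) ^ (2 * δ) ≤ (c * n) ^ (1 : ℝ) :=
                Real.rpow_le_rpow_of_exponent_le hgt.le (by linarith)
            _ = c * n := Real.rpow_one _
        have hue : (c * n) * Real.exp (-(c * n)) ≤ 1 := by
          have h := Real.add_one_le_exp (c * n)
          rw [Real.exp_neg, ← div_eq_mul_inv, div_le_one (Real.exp_pos _)]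
          linarith
        exact (mul_le_mul_of_nonneg_right hus (Real.exp_pos _).le).trans hue
    rw [hG]
    dsimp only
    rw [mul_pow, ← Real.rpow_natCast ((n : ℝ) ^ δ) 2, ← Real.rpow_mul hn0, ← Real.exp_nat_mul]
    have h1 : (n : ℝ) ^ (δ * (2 : ℕ)) = c ^ (-(2 * δ)) * (c * n) ^ (2 * δ) := by
      rw [Real.mul_rpow hcpos.le hn0, ← mul_assoc, ← Real.rpow_add hcpos,
        show -(2 * δ) + 2 * δ = 0 by ring, Real.rpow_zero, one_mul]
      congr 1
      push_cast
      ring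
    have h2 : Real.exp ((2 : ℕ) * (-c * n)) = Real.exp (-(c * n)) * Real.exp (-c * n) := by
      rw [← Real.exp_add]; congr 1; push_cast; ring
    rw [h1, h2]
    calc c ^ (-(2 * δ)) * (c * n) ^ (2 * δ) * (Real.exp (-(c * n)) * Real.exp (-c * n))
        = c ^ (-(2 * δ)) * Real.exp (-c * n) * ((c * n) ^ (2 * δ) * Real.exp (-(c * n))) := by ring
      _ ≤ c ^ (-(2 * δ)) * Real.exp (-c * n) * 1 :=
          mul_le_mul_of_nonneg_left key (by positivity)
      _ = _ := mul_one _
  -- partial sums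
  have hpartial : ∀ M' : ℕ, ∑ n ∈ Finset.range M', ‖b n‖ * (Real.exp (-(2 * Real.pi * n) * y) / n) ≤
      Real.sqrt S * c ^ (-(1 + 2 * δ) / 2) := by
    intro M'
    simp_rw [hterm]
    have hCS := Finset.sum_mul_sq_le_sq_mul_sq (Finset.range M') F G
    have hA : ∑ n ∈ Finset.range M', F n ^ 2 ≤ S := by
      simp_rw [hF2]
      exact hS.sum_le_tsum _ (fun n _ ↦ by positivity)
    have hB : ∑ n ∈ Finset.range M', G n ^ 2 ≤ c ^ (-(1 + 2 * δ)) := by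
      rcases Nat.eq_zero_or_pos M' with rfl | hM'
      · rw [Finset.sum_range_zero]; positivity
      obtain ⟨M'', rfl⟩ : ∃ M'', M' = M'' + 1 := ⟨M' - 1, by omega⟩
      rw [Finset.sum_range_succ']
      have hG0 : G 0 ^ 2 = 0 := by simp [hG, Real.zero_rpow hδ0.ne']
      rw [hG0, add_zero]
      calc ∑ n ∈ Finset.range M'', G (n + 1) ^ 2
          ≤ ∑ n ∈ Finset.range M'', c ^ (-(2 * δ)) * Real.exp (-c * ((n : ℝ) + 1)) := by
            refine Finset.sum_le_sum fun n _ ↦ ?_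
            have := hG2 (n + 1)
            push_cast at this
            exact this
        _ = c ^ (-(2 * δ)) * ∑ n ∈ Finset.range M'', Real.exp (-c * ((n : ℝ) + 1)) := by
            rw [Finset.mul_sum]
        _ ≤ c ^ (-(2 * δ)) * (1 / c) :=
            mul_le_mul_of_nonneg_left (sum_range_exp_neg_mul_succ_le hcpos M'') (by positivity)
        _ = c ^ (-(1 + 2 * δ)) := by
            rw [one_div, ← Real.rpow_neg_one c, ← Real.rpow_add hcpos]
            congr 1; ring
    have hsq : (∑ n ∈ Finset.range M', F n * G n) ^ 2 ≤ S * c ^ (-(1 + 2 * δ)) :=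
      hCS.trans (mul_le_mul hA hB (Finset.sum_nonneg fun n _ ↦ by positivity) hS0)
    have habs := Real.abs_le_sqrt hsq
    rw [abs_of_nonneg (Finset.sum_nonneg fun n _ ↦ by positivity)] at habs
    refine habs.trans (le_of_eq ?_)
    rw [Real.sqrt_mul hS0, Real.sqrt_eq_rpow (c ^ _), ← Real.rpow_mul hcpos.le]
    congr 2
    ring
  exact Real.tsum_le_of_sum_range_le (fun n ↦ by positivity) hpartial

end MeanSquare

/-! ### The dual-term error from the mean square -/

section DualMeanSquare

open ModularForms UpperHalfPlane LFunctions

variable {N : ℕ} (f : CuspForm (CongruenceSubgroup.Gamma0 N) 2)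

/-- **The dual-term error for a sparse family, from the mean square of the dual form.** As
`norm_dampedTwist_dual_le_of_card_support`, but using for the coefficients of `f` only Hecke's
bound `|aₙ| ≤ C' n` (for summability) and the mean square `S = ∑ |aₙ|² n^{-2-2δ} < ∞`
(`0 < δ ≤ 1/2`; Rankin): `‖D_f(B, Y')‖ ≤ #X · (R₁ K_M) · S^{1/2} (2πY')^{-(1+2δ)/2}`
(`tsum_norm_mul_exp_div_le`). [folklore] -/
theorem norm_dampedTwist_dual_le_of_card_support_of_summable {M : ℕ} [NeZero M]
    (hMN : M.Coprime N) (X : Finset (DirichletCharacter ℂ M)) {R₁ : ℕ}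
    (hR : (Finset.univ.filter fun z : ZMod M ↦ ∑ χ ∈ X, χ z ≠ 0).card ≤ R₁)
    {KM : ℝ} (hK : ∀ b : ZMod M, ‖kloostermanSum M 1 b‖ ≤ KM)
    {C' : ℝ} (hb : ∀ n : ℕ, ‖cuspCoeff f n‖ ≤ C' * n) {δ : ℝ} (hδ0 : 0 < δ) (hδ1 : δ ≤ 1 / 2)
    (hS : Summable fun n : ℕ ↦ ‖cuspCoeff f n‖ ^ 2 / (n : ℝ) ^ (2 + 2 * δ)) {Y' : ℝ}
    (hY' : 0 < Y') :
    ‖dampedTwist f (fun n ↦ ∑ χ ∈ X,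
        χ N * gaussSum χ (ZMod.stdAddChar (N := M)) ^ 2 * χ⁻¹ n) Y'‖ ≤
      X.card * ((R₁ * KM) *
        (Real.sqrt (∑' n : ℕ, ‖cuspCoeff f n‖ ^ 2 / (n : ℝ) ^ (2 + 2 * δ)) *
          (2 * Real.pi * Y') ^ (-(1 + 2 * δ) / 2))) := by
  classical
  have hKM : 0 ≤ KM := (norm_nonneg _).trans (hK 0)
  have hC' : 0 ≤ C' := by
    have h := hb 1
    simp only [Nat.cast_one, mul_one] at h
    exact (norm_nonneg _).trans h
  set β : ℝ := R₁ * KM with hβ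
  have hβ0 : 0 ≤ β := by positivity
  set Bw : ℕ → ℂ := fun n ↦ ∑ χ ∈ X, χ N * gaussSum χ (ZMod.stdAddChar (N := M)) ^ 2 * χ⁻¹ n
    with hBw
  set c : ℝ := 2 * Real.pi * Y' with hc
  have hcpos : 0 < c := by positivity
  have hNu : IsUnit ((N : ℕ) : ZMod M) := by
    rw [ZMod.isUnit_iff_coprime]; exact hMN.symm
  -- bound for the weight
  have hBle : ∀ n : ℕ, ‖Bw n‖ ≤ X.card * β := by
    intro n
    by_cases hn : IsUnit ((n : ℕ) : ZMod M)
    · have : Bw n = ∑ χ ∈ X, χ ((N : ZMod M) * ((n : ℕ) : ZMod M)⁻¹) *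
          gaussSum χ (ZMod.stdAddChar (N := M)) ^ 2 := by
        refine Finset.sum_congr rfl fun χ _ ↦ ?_
        rw [← mul_inv_apply_eq_mod χ _ hn]; ring
      rw [this]
      have hyu : IsUnit ((N : ZMod M) * ((n : ℕ) : ZMod M)⁻¹) := by
        refine hNu.mul ?_
        rw [← hn.unit_spec, ZMod.inv_coe_unit]; exact Units.isUnit _
      have h := norm_sum_mul_gaussSum_sq_le_of_card_support X hR hK hyu
      rw [hβ]
      refine h.trans (le_of_eq ?_)
      ring
    · have : Bw n = 0 := Finset.sum_eq_zero fun χ _ ↦ by rw [MulChar.map_nonunit χ⁻¹ hn, mul_zero]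
      rw [this, norm_zero]; positivity
  -- the majorant
  set h : ℕ → ℝ := fun n ↦ X.card * β * (‖cuspCoeff f n‖ * (Real.exp (-(2 * Real.pi * n) * Y') / n))
    with hh
  have hh0 : ∀ n, 0 ≤ h n := fun n ↦ by positivity
  have hh_le : ∀ n, h n ≤ X.card * β * C' * Real.exp (-c * n) := by
    intro n
    rcases Nat.eq_zero_or_pos n with rfl | hnpos
    · simp only [hh, Nat.cast_zero, div_zero, mul_zero]; positivity
    have hnr : (0 : ℝ) < n := Nat.cast_pos.mpr hnpos
    rw [hh]
    dsimp only
    have h1 : ‖cuspCoeff f n‖ * (Real.exp (-(2 * Real.pi * n) * Y') / n) ≤ C' * Real.exp (-c * n) := by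
      rw [mul_div_assoc', div_le_iff₀ hnr, show -(2 * Real.pi * n) * Y' = -c * n by rw [hc]; ring]
      calc ‖cuspCoeff f n‖ * Real.exp (-c * n) ≤ (C' * n) * Real.exp (-c * n) :=
            mul_le_mul_of_nonneg_right (hb n) (Real.exp_pos _).le
        _ = C' * Real.exp (-c * n) * n := by ring
    calc (X.card : ℝ) * β * (‖cuspCoeff f n‖ * (Real.exp (-(2 * Real.pi * n) * Y') / n))
        ≤ X.card * β * (C' * Real.exp (-c * n)) := mul_le_mul_of_nonneg_left h1 (by positivity)
      _ = _ := by ring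
  have hgeom : Summable fun n : ℕ ↦ X.card * β * C' * Real.exp (-c * n) := by
    have : Summable fun n : ℕ ↦ Real.exp (-c) ^ n :=
      summable_geometric_of_lt_one (Real.exp_pos _).le (Real.exp_lt_one_iff.mpr (by linarith))
    refine (this.mul_left (X.card * β * C')).congr fun n ↦ ?_
    rw [← Real.exp_nat_mul]; congr 1; ring
  have hh_summable : Summable h := Summable.of_nonneg_of_le hh0 hh_le hgeom
  have hpt : ∀ n : ℕ, ‖Bw n * cuspCoeff f n * (Real.exp (-(2 * Real.pi * n) * Y') / n : ℝ)‖ ≤ h n := by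
    intro n
    rw [norm_mul, norm_mul, Complex.norm_real, Real.norm_of_nonneg (by positivity), hh]
    dsimp only
    rw [mul_assoc]
    exact mul_le_mul_of_nonneg_right (hBle n) (by positivity)
  have htsum : ∑' n, h n ≤ X.card * β * (Real.sqrt (∑' n : ℕ, ‖cuspCoeff f n‖ ^ 2 / (n : ℝ) ^ (2 + 2 * δ)) *
      c ^ (-(1 + 2 * δ) / 2)) := by
    rw [hh, tsum_mul_left]
    exact mul_le_mul_of_nonneg_left (tsum_norm_mul_exp_div_le hδ0 hδ1 hS hY') (by positivity)
  rw [dampedTwist]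
  refine (tsum_of_norm_bounded hh_summable.hasSum hpt).trans (htsum.trans (le_of_eq ?_))
  rw [hβ, hc]; ring

end DualMeanSquare

/-! ### Asymptotics in the conductor with any power-saving coefficient bound `θ < 1` -/

section FinalMeanSquare

open ModularForms UpperHalfPlane LFunctions Filter Topology

variable {N : ℕ} [NeZero N] (f : CuspForm (CongruenceSubgroup.Gamma0 N) 2)

/-- **Rankin's mean square for the dual form**: for `g ∈ S₂(Γ₀(N))` and `δ > 0`,
`∑ |bₙ|² n^{-2-2δ} < ∞` (`sum_Ico_sq_cuspCoeff_le`, `summable_div_rpow_of_sum_Ico_le`).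
[cite: Rankin1977, Thm. 4.5.2 (iii)] -/
theorem summable_norm_cuspCoeff_sq_div_rpow (g : CuspForm (CongruenceSubgroup.Gamma0 N) 2)
    {δ : ℝ} (hδ : 0 < δ) : Summable fun n : ℕ ↦ ‖cuspCoeff g n‖ ^ 2 / (n : ℝ) ^ (2 + 2 * δ) := by
  obtain ⟨Cg, hCg⟩ := CuspFormClass.exists_bound g
  exact summable_div_rpow_of_sum_Ico_le (fun n ↦ by positivity)
    (sum_Ico_sq_cuspCoeff_le one_mem_strictPeriods_Gamma0 g hCg) (by push_cast; linarith)

/-- **No admissible family of large `P`-smooth conductor is killed by the symbol sums — any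
power saving `θ < 1`.** As `exists_forall_family_exists_twistedSymbolSum_ne_zero_mod`, but the
coefficient bound `|aₙ(f)| ≤ C n^θ` is only required for some `θ < 1` (here `3/4 ≤ θ < 1`): the
dual term is estimated through the mean square of the dual form
(`norm_dampedTwist_dual_le_of_card_support_of_summable`, Rankin's bound
`summable_norm_cuspCoeff_sq_div_rpow`), which gives `(1/M) D_g(B, Y') ≪ #X M^{(2-a)(1+2δ)/2 - 1/2}`
for `Y = M^{-a}`; with `1 < a < 1/θ` and `δ = (a-1)/4` both this exponent `= -a(a-1)/4` and the
main-term exponent `aθ - 1` are negative. So the only pointwise input is a bound `o(n)` with a power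
saving at the (sparse) integers of the support. [folklore] -/
theorem exists_forall_family_exists_twistedSymbolSum_ne_zero_mod'
    {g : CuspForm (CongruenceSubgroup.Gamma0 N) 2} (hW : IsFrickePair N f g)
    {P : Finset ℕ} (hP : ∀ q ∈ P, q.Prime) (hPN : ∀ q ∈ P, ¬ q ∣ N)
    {C θ : ℝ} (hC : 0 ≤ C) (hθ : 3 / 4 ≤ θ) (hθ1 : θ < 1)
    (ha : ∀ n : ℕ, ‖cuspCoeff f n‖ ≤ C * (n : ℝ) ^ θ) (h1 : cuspCoeff f 1 = 1)
    (R₁ : ℕ) {L : ℕ} (hL : 0 < L) :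
    ∃ M₀ : ℕ, ∀ M : ℕ, M₀ ≤ M → ∀ [NeZero M], M.primeFactors ⊆ P →
      ∀ (X : Finset (DirichletCharacter ℂ M)) (ε : ℂ), X.Nonempty →
      (∀ χ ∈ X, χ.IsPrimitive ∧ χ (-1) = ε) →
      (Finset.univ.filter fun z : ZMod M ↦ ∑ χ ∈ X, χ z ≠ 0).card ≤ R₁ →
      (∀ z : ZMod M, ∑ χ ∈ X, χ z ≠ 0 → z ^ L = 1) →
      ∃ χ ∈ X, twistedSymbolSum f χ⁻¹ ≠ 0 := by
  have hNr : (0 : ℝ) < N := Nat.cast_pos.mpr (NeZero.pos N)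
  have h2π : (0 : ℝ) < 2 * Real.pi := Real.two_pi_pos
  have hLr : (0 : ℝ) < L := Nat.cast_pos.mpr hL
  have hθ0 : 0 < θ := by linarith
  -- the exponent `a`, `1 < a < 1/θ`, `a ≤ 7/6`
  set a : ℝ := (1 + 1 / θ) / 2 with hadef
  have haθ' : a * θ = (θ + 1) / 2 := by rw [hadef]; field_simp
  have haθ : a * θ - 1 < 0 := by rw [haθ']; linarith
  have h1θ : 1 < 1 / θ := by rw [lt_div_iff₀ hθ0]; linarith
  have h1θ' : 1 / θ ≤ 4 / 3 := by rw [div_le_div_iff₀ hθ0 (by norm_num)]; linarith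
  have ha1 : 1 < a := by rw [hadef]; linarith
  have ha76 : a ≤ 7 / 6 := by rw [hadef]; linarith
  have ha0 : 0 < a := by linarith
  -- the mean-square parameter `δ` and the dual exponent
  set δ : ℝ := (a - 1) / 4 with hδdef
  have hδ0 : 0 < δ := by rw [hδdef]; linarith
  have hδ1 : δ ≤ 1 / 2 := by rw [hδdef]; linarith
  set s : ℝ := (1 + 2 * δ) / 2 with hsdef
  have hdual : (2 - a) * s - 1 / 2 < 0 := by
    have : (2 - a) * s - 1 / 2 = -(a * (a - 1) / 4) := by rw [hsdef, hδdef]; ring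
    rw [this]
    have : 0 < a * (a - 1) / 4 := by have := mul_pos ha0 (sub_pos.mpr ha1); linarith
    linarith
  -- the dual form: Hecke's bound and Rankin's mean square
  obtain ⟨C', hC'0, hb⟩ := exists_norm_cuspCoeff_le_mul g
  have hS := summable_norm_cuspCoeff_sq_div_rpow g hδ0
  set Sg : ℝ := ∑' n : ℕ, ‖cuspCoeff g n‖ ^ 2 / (n : ℝ) ^ (2 + 2 * δ) with hSg
  -- the Kloosterman constant
  set cP : ℝ := ∏ ℓ ∈ P, 4 * (ℓ : ℝ) with hcP
  have hcP0 : 0 ≤ cP := Finset.prod_nonneg fun ℓ _ ↦ by positivity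
  -- the parameter `Y = M^{-a}`
  set Y : ℕ → ℝ := fun M ↦ (M : ℝ) ^ (-a) with hYdef
  have hYpos : ∀ M, 0 < M → 0 < Y M := fun M hM ↦
    Real.rpow_pos_of_pos (Nat.cast_pos.mpr hM) _
  -- the error sequences
  set e₁ : ℝ := (θ - 1) / L with he₁
  set K₃ : ℝ := Real.Gamma θ * (2 * Real.pi) ^ (-θ) with hK₃
  set err₁ : ℕ → ℝ := fun M ↦ C * (R₁ *
    ((M : ℝ) ^ e₁ + ((M : ℝ) ^ (θ - 1) + K₃ * (M : ℝ) ^ (a * θ - 1)))) with herr₁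
  set K₄ : ℝ := R₁ * cP * (Real.sqrt Sg * (2 * Real.pi / N) ^ (-s)) with hK₄
  set err₂ : ℕ → ℝ := fun M ↦ K₄ * (M : ℝ) ^ ((2 - a) * s - 1 / 2) with herr₂
  -- limits
  have hXlim : Tendsto (fun M : ℕ ↦ (M : ℝ)) atTop atTop := tendsto_natCast_atTop_atTop
  have hrpow : ∀ {Z : ℕ → ℝ} (_ : Tendsto Z atTop atTop) {e : ℝ} (_ : e < 0),
      Tendsto (fun m ↦ Z m ^ e) atTop (𝓝 0) := by
    intro Z hZ e he
    have h := (tendsto_rpow_neg_atTop (neg_pos.mpr he)).comp hZ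
    simp only [neg_neg] at h
    exact h
  have he₁neg : e₁ < 0 := div_neg_of_neg_of_pos (by linarith) hLr
  have herr₁lim : Tendsto err₁ atTop (𝓝 0) := by
    have h := ((hrpow hXlim he₁neg).add ((hrpow hXlim (by linarith : θ - 1 < 0)).add
      ((hrpow hXlim haθ).const_mul K₃))).const_mul (R₁ : ℝ) |>.const_mul C
    simpa [herr₁] using h
  have herr₂lim : Tendsto err₂ atTop (𝓝 0) := by
    have h := (hrpow hXlim hdual).const_mul K₄
    simpa [herr₂] using h
  have hexplim : Tendsto (fun M ↦ Real.exp (-(2 * Real.pi) * Y M)) atTop (𝓝 1) := by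
    have hY0 : Tendsto Y atTop (𝓝 0) := hrpow hXlim (by linarith : -a < 0)
    have h0 : Tendsto (fun M ↦ -(2 * Real.pi) * Y M) atTop (𝓝 0) := by
      simpa using hY0.const_mul (-(2 * Real.pi))
    have := (Real.continuous_exp.tendsto 0).comp h0
    rw [Real.exp_zero] at this
    refine this.congr fun M ↦ ?_
    simp only [Function.comp_apply]
  -- choose `M₀`
  have hev : ∀ᶠ M in atTop, err₁ M + err₂ M < 1 / 2 ∧ 1 / 2 < Real.exp (-(2 * Real.pi) * Y M) ∧
      1 ≤ M := by
    refine ((herr₁lim.add herr₂lim).eventually (gt_mem_nhds ?_)).and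
      ((hexplim.eventually (lt_mem_nhds ?_)).and (eventually_ge_atTop 1))
    · norm_num
    · norm_num
  obtain ⟨M₀, hM₀⟩ := eventually_atTop.mp hev
  refine ⟨M₀, fun M hM _ hMP Xf ε hne hXf hR hsupp ↦ ?_⟩
  obtain ⟨hlt, hexp, hM1⟩ := hM₀ M hM
  have hMpos : 0 < M := hM1
  have hMr : (0 : ℝ) < M := Nat.cast_pos.mpr hMpos
  have hMN : M.Coprime N := coprime_of_primeFactors_subset hPN hMpos.ne' hMP
  -- suppose all the twisted symbol sums vanish
  by_contra hall
  push Not at hall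
  have hcard : 0 < (Xf.card : ℝ) := by exact_mod_cast Finset.card_pos.mpr hne
  have hε : ε ≠ 0 := by
    obtain ⟨χ, hχ⟩ := hne
    rw [← (hXf χ hχ).2]
    rcases apply_neg_one_eq_one_or χ with h | h
    · rw [h]; exact one_ne_zero
    · rw [h]; exact neg_ne_zero.mpr one_ne_zero
  have hmom : ∑ χ ∈ Xf, gaussSum χ (ZMod.stdAddChar (N := M)) / (M : ℂ) *
      twistedSymbolSum f χ⁻¹ = 0 :=
    Finset.sum_eq_zero fun χ hχ ↦ by rw [hall χ hχ, mul_zero]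
  rw [sum_family_twistedSymbolSum_eq_of_coprime f hW hMN Xf hXf (hYpos M hMpos)] at hmom
  replace hmom := (mul_eq_zero.mp hmom).resolve_left hε
  -- the two error bounds at `Y = Y M`
  have hE₁ := norm_dampedTwist_sum_sub_le_of_card_support f Xf hR hL hsupp hC hθ0 hθ1.le
    ha h1 (hYpos M hMpos)
  have hY'pos : 0 < 1 / ((N : ℝ) * (M : ℕ) ^ 2 * Y M) := by
    have := hYpos M hMpos
    positivity
  have hK : ∀ b : ZMod M, ‖kloostermanSum M 1 b‖ ≤ cP * (M : ℝ) ^ (1 / 2 : ℝ) :=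
    norm_kloostermanSum_one_le_sqrt hP hMP
  have hE₂ := norm_dampedTwist_dual_le_of_card_support_of_summable g hMN Xf hR hK hb hδ0 hδ1 hS
    hY'pos
  -- simplify the error bounds to `#X · err₁ M` and `#X · err₂ M`
  have hA : ((M : ℝ) ^ (1 / L : ℝ)) ^ (θ - 1) = (M : ℝ) ^ e₁ := by
    rw [← Real.rpow_mul hMr.le, he₁]
    congr 1
    field_simp
  have hB : (M : ℝ) ^ (θ - 1) * (1 + Real.Gamma θ * (2 * Real.pi * Y M * (M : ℝ)) ^ (-θ)) =
      (M : ℝ) ^ (θ - 1) + K₃ * (M : ℝ) ^ (a * θ - 1) := by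
    rw [hYdef]
    dsimp only
    rw [hK₃]
    have h := main_exponent_eq_offset (θ := θ) (a := a) one_pos hMr
    rw [one_mul, Real.one_rpow, mul_one] at h
    linear_combination Real.Gamma θ * h
  have hE₁' : ‖dampedTwist f (fun n ↦ ∑ χ ∈ Xf, χ n) (Y M) -
      Xf.card * (Real.exp (-(2 * Real.pi) * Y M) : ℝ)‖ ≤ Xf.card * err₁ M := by
    have h := hE₁
    rw [hA, hB] at h
    simpa only [herr₁] using h
  have hE₂' : ‖(1 / (M : ℂ)) * dampedTwist g (fun n ↦ ∑ χ ∈ Xf,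
      χ N * gaussSum χ (ZMod.stdAddChar (N := M)) ^ 2 * χ⁻¹ n) (1 / ((N : ℝ) * (M : ℕ) ^ 2 * Y M))‖ ≤
      Xf.card * err₂ M := by
    rw [norm_mul, norm_div, norm_one, show ‖(M : ℂ)‖ = (M : ℝ) by
      rw [Complex.norm_natCast]]
    refine (mul_le_mul_of_nonneg_left hE₂ (by positivity)).trans ?_
    have hZ : (2 * Real.pi * (1 / ((N : ℝ) * (M : ℝ) ^ 2 * Y M))) ^ (-s) =
        (2 * Real.pi / N) ^ (-s) * (M : ℝ) ^ ((2 - a) * s) := by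
      rw [hYdef]; exact dual_exponent_eq_offset hNr hMr
    have hsneg : -(1 + 2 * δ) / 2 = -s := by rw [hsdef]; ring
    have hx2 : (M : ℝ) ^ (1 / 2 : ℝ) * (M : ℝ) ^ ((2 - a) * s) / (M : ℝ) =
        (M : ℝ) ^ ((2 - a) * s - 1 / 2) := by
      rw [div_eq_iff hMr.ne', ← Real.rpow_add hMr, ← Real.rpow_add_one hMr.ne']
      congr 1; ring
    rw [hsneg, hZ]
    calc 1 / (M : ℝ) * ((Xf.card) * ((R₁ * (cP * (M : ℝ) ^ (1 / 2 : ℝ))) *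
          (Real.sqrt Sg * ((2 * Real.pi / N) ^ (-s) * (M : ℝ) ^ ((2 - a) * s)))))
        = (Xf.card) * (R₁ * cP * (Real.sqrt Sg * (2 * Real.pi / N) ^ (-s))) *
          ((M : ℝ) ^ (1 / 2 : ℝ) * (M : ℝ) ^ ((2 - a) * s) / (M : ℝ)) := by
          ring
      _ = (Xf.card) * err₂ M := by
          rw [hx2]
          simp only [herr₂, hK₄]
          ring
      _ ≤ (Xf.card) * err₂ M := le_rfl
  -- the contradiction
  have hkey : (Xf.card : ℝ) * Real.exp (-(2 * Real.pi) * Y M) ≤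
      Xf.card * err₁ M + Xf.card * err₂ M := by
    have hnorm : ‖((Xf.card) * (Real.exp (-(2 * Real.pi) * Y M) : ℝ) : ℂ)‖ =
        (Xf.card : ℝ) * Real.exp (-(2 * Real.pi) * Y M) := by
      rw [show ((Xf.card) * (Real.exp (-(2 * Real.pi) * Y M) : ℝ) : ℂ) =
        (((Xf.card) * Real.exp (-(2 * Real.pi) * Y M) : ℝ) : ℂ) by push_cast; ring,
        Complex.norm_real, Real.norm_of_nonneg (by positivity)]
    rw [← hnorm]
    set D₁ := dampedTwist f (fun n ↦ ∑ χ ∈ Xf, χ n) (Y M)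
    set D₂ := (1 / (M : ℂ)) * dampedTwist g (fun n ↦ ∑ χ ∈ Xf,
      χ N * gaussSum χ (ZMod.stdAddChar (N := M)) ^ 2 * χ⁻¹ n) (1 / ((N : ℝ) * (M : ℕ) ^ 2 * Y M))
    have hD : D₁ = D₂ := sub_eq_zero.mp hmom
    calc ‖((Xf.card) * (Real.exp (-(2 * Real.pi) * Y M) : ℝ) : ℂ)‖
        = ‖((((Xf.card) * (Real.exp (-(2 * Real.pi) * Y M) : ℝ) : ℂ) - D₁) + D₂)‖ := by
          rw [hD, sub_add_cancel]
      _ ≤ ‖((Xf.card) * (Real.exp (-(2 * Real.pi) * Y M) : ℝ) : ℂ) - D₁‖ + ‖D₂‖ :=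
          norm_add_le _ _
      _ ≤ _ := by
          refine add_le_add ?_ hE₂'
          rw [norm_sub_rev]; exact hE₁'
  have : Real.exp (-(2 * Real.pi) * Y M) ≤ err₁ M + err₂ M := by
    have h := hkey
    rw [← mul_add] at h
    exact le_of_mul_le_mul_left h hcard
  linarith

end FinalMeanSquare

/-! ### Rohrlich's theorem for an arbitrary newform and an arbitrary finite set of primes `P` -/

section MainComposite

open ModularForms UpperHalfPlane LFunctions

variable {N : ℕ} [NeZero N] {f : CuspForm (CongruenceSubgroup.Gamma0 N) 2}

/-- **The exceptional characters are finite in number as soon as no admissible family of large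
`P`-smooth conductor is killed** — the algebraic half of Rohrlich's argument (Birch's formula, the
Galois step `twistedSymbolSum_pow_eq_zero_of_modEq_one_step`, the family `ψ⟨ψ^r⟩` with its
primitivity, parity and support properties), separated from the analytic input `hfam` (supplied by
`exists_forall_family_exists_twistedSymbolSum_ne_zero_mod` or its mean-square variant
`exists_forall_family_exists_twistedSymbolSum_ne_zero_mod'`); the argument is the one described at
`Rohrlich1984_of_coeffBound`. [cite: RohrlichInventiones1984, Theorem (p. 409)] -/
theorem finite_exceptional_of_forall_family (hf : IsNewform0 f) (P : Finset ℕ)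
    (hfam : ∀ (R₁ : ℕ) {L : ℕ}, 0 < L → ∃ M₀ : ℕ, ∀ M : ℕ, M₀ ≤ M → ∀ [NeZero M],
      M.primeFactors ⊆ P.filter Nat.Prime →
      ∀ (X : Finset (DirichletCharacter ℂ M)) (ε : ℂ), X.Nonempty →
      (∀ χ ∈ X, χ.IsPrimitive ∧ χ (-1) = ε) →
      (Finset.univ.filter fun z : ZMod M ↦ ∑ χ ∈ X, χ z ≠ 0).card ≤ R₁ →
      (∀ z : ZMod M, ∑ χ ∈ X, χ z ≠ 0 → z ^ L = 1) →
      ∃ χ ∈ X, twistedSymbolSum f χ⁻¹ ≠ 0) :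
    Set.Finite {χ : Σ m : ℕ, DirichletCharacter ℂ m |
      χ.1 ≠ 0 ∧ χ.1.primeFactors ⊆ P ∧ χ.2.IsPrimitive ∧
        ∃ L : ℂ → ℂ, Differentiable ℂ L ∧
          (∀ s : ℂ, 2 < s.re → L s = twistedLSeries f χ.2 s) ∧ L 1 = 0} := by
  classical
  -- the primes of `P`
  set P' : Finset ℕ := P.filter Nat.Prime with hP'def
  have hP' : ∀ q ∈ P', q.Prime := fun q hq ↦ (Finset.mem_filter.mp hq).2
  have hsub : ∀ {M : ℕ}, M.primeFactors ⊆ P → M.primeFactors ⊆ P' := fun h ℓ hℓ ↦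
    Finset.mem_filter.mpr ⟨h hℓ, Nat.prime_of_mem_primeFactors hℓ⟩
  -- the step `r`
  set n₀ : ℕ := Module.finrank ℚ (coeffField f) with hn₀
  set r : ℕ := (∏ q ∈ P', q ^ (padicValNat q n₀.factorial + 2)) * ∏ q ∈ P', (q - 1) with hrdef
  have hrpos : 0 < r := by
    refine Nat.mul_pos (Finset.prod_pos fun q hq ↦ pow_pos (hP' q hq).pos _)
      (Finset.prod_pos fun q hq ↦ ?_)
    have := (hP' q hq).two_le
    omega
  have hrP : ∀ q ∈ P', q ^ (padicValNat q n₀.factorial + 2) ∣ r := fun q hq ↦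
    dvd_mul_of_dvd_left (Finset.dvd_prod_of_mem _ hq) _
  have hr1 : ∏ q ∈ P', (q - 1) ∣ r := dvd_mul_left _ _
  have hmodr : ∀ j : ℕ, 1 + r * j ≡ 1 [MOD r] := fun j ↦ by
    change (1 + r * j) % r = 1 % r
    exact Nat.add_mul_mod_self_left 1 r j
  -- the threshold `M₀` of the family theorem
  obtain ⟨M₀, hM₀⟩ := hfam (r * (4 * ∏ ℓ ∈ P', ℓ)) hrpos
  -- the finite set of characters of conductor `M ≤ M₁ = max M₀ 1`
  set M₁ : ℕ := max M₀ 1 with hM₁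
  have hfin : Set.Finite (⋃ M ∈ (↑(Finset.Icc 1 M₁) : Set ℕ),
      Set.range (Sigma.mk (β := fun n : ℕ ↦ DirichletCharacter ℂ n) M)) := by
    refine (Finset.Icc 1 M₁).finite_toSet.biUnion fun M hM ↦ ?_
    haveI : NeZero M := ⟨by have := (Finset.mem_Icc.mp hM).1; omega⟩
    exact Set.finite_range _
  refine hfin.subset ?_
  rintro ⟨M, ψ⟩ ⟨hM0, hMP, hprim, L, hLd, hL, hL1⟩
  dsimp only at hM0 hMP hprim hL hL1
  simp only [Set.mem_iUnion, Set.mem_range, Finset.coe_Icc, Set.mem_Icc]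
  by_contra hmem
  push Not at hmem
  have hM' : M₁ < M := by
    by_contra hlt
    push Not at hlt
    exact hmem M ⟨Nat.one_le_iff_ne_zero.mpr hM0, hlt⟩ ψ rfl
  have hM : M₀ < M := lt_of_le_of_lt (le_max_left _ _) hM'
  have hM2 : 2 ≤ M := by
    have := le_max_right M₀ 1
    omega
  haveI : NeZero M := ⟨hM0⟩
  have hMP' : M.primeFactors ⊆ P' := hsub hMP
  -- `M ≥ 2` has a prime factor, so `P'` is non-empty and `r` is even
  obtain ⟨ℓ₀, hℓ₀⟩ : M.primeFactors.Nonempty := Nat.nonempty_primeFactors.mpr (by omega)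
  have hr2 : 2 ∣ r := by
    have hℓ₀P : ℓ₀ ∈ P' := hMP' hℓ₀
    rcases (hP' ℓ₀ hℓ₀P).eq_two_or_odd' with h2 | hodd
    · subst h2
      exact (dvd_pow_self 2 (Nat.add_pos_right _ two_pos).ne').trans (hrP 2 hℓ₀P)
    · have h1' : Even (ℓ₀ - 1) := Nat.Odd.sub_odd hodd odd_one
      exact ((even_iff_two_dvd.mp h1').trans
        (Finset.dvd_prod_of_mem (fun q : ℕ ↦ q - 1) hℓ₀P)).trans hr1
  have hodd : ∀ j : ℕ, Odd (1 + r * j) := fun j ↦ by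
    obtain ⟨c, hc⟩ := hr2
    exact ⟨c * j, by rw [hc]; ring⟩
  have hrℓ : ∀ ℓ ∈ M.primeFactors, ℓ - 1 ∣ r := fun ℓ hℓ ↦
    (Finset.dvd_prod_of_mem (fun q : ℕ ↦ q - 1) (hMP' hℓ)).trans hr1
  -- Birch's formula: `L(f, ψ, 1) = 0` gives `∑_a ψ̄(a){∞, a/M}_f = 0`
  have hS : twistedSymbolSum f ψ⁻¹ = 0 := by
    have h := twisted_LValue_eq_holds f hprim hLd hL
    rw [hL1, mul_zero] at h
    exact h.symm
  -- the Galois family `ψ⟨ψ^r⟩` of `ψ`: primitive, constant parity, sparse support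
  set Xf : Finset (DirichletCharacter ℂ M) :=
    (Finset.range (orderOf (ψ ^ r))).image (fun j ↦ ψ * (ψ ^ r) ^ j) with hXf
  have hmem' : ∀ χ' ∈ Xf, ∃ j, χ' = ψ ^ (1 + r * j) := fun χ' h ↦ by
    obtain ⟨j, -, hj⟩ := (mem_galoisCoset_iff ψ r).mp h
    exact ⟨j, hj⟩
  have hordψ : orderOf ψ ∣ Nat.totient M := by
    refine orderOf_dvd_of_pow_eq_one ?_
    ext u
    rw [MulChar.pow_apply_coe, MulChar.one_apply_coe, ← map_pow, ← Units.val_pow_eq_pow_val,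
      ZMod.pow_totient, Units.val_one, map_one]
  have hX : ∀ χ' ∈ Xf, χ'.IsPrimitive ∧ χ' (-1) = ψ (-1) := by
    intro χ' h
    obtain ⟨j, rfl⟩ := hmem' χ' h
    have hcop : (1 + r * j).Coprime (orderOf ψ) :=
      (coprime_totient_of_modEq_one_step hM0 hMP' n₀ hrP hr1 (hmodr j)).coprime_dvd_right hordψ
    refine ⟨isPrimitive_pow_of_coprime_orderOf hprim hcop, ?_⟩
    rw [MulChar.pow_apply' ψ (by omega : 1 + r * j ≠ 0)]
    rcases apply_neg_one_eq_one_or ψ with h' | h'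
    · rw [h', one_pow]
    · rw [h', (hodd j).neg_one_pow]
  have hR : (Finset.univ.filter fun z : ZMod M ↦ ∑ χ ∈ Xf, χ z ≠ 0).card ≤
      r * (4 * ∏ ℓ ∈ P', ℓ) := by
    have hsub' : (Finset.univ.filter fun z : ZMod M ↦ ∑ χ ∈ Xf, χ z ≠ 0) ⊆
        Finset.univ.filter fun z : ZMod M ↦ IsUnit z ∧ ψ z ^ r = 1 := by
      intro z hz
      rw [Finset.mem_filter] at hz ⊢
      exact ⟨hz.1, isUnit_and_pow_eq_one_of_sum_galoisCoset_ne_zero ψ r hz.2⟩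
    refine ((Finset.card_le_card hsub').trans (card_filter_apply_pow_eq_one_le hprim hrpos)).trans ?_
    refine Nat.mul_le_mul_left _ (Nat.mul_le_mul_left _ ?_)
    exact Finset.prod_le_prod_of_subset_of_one_le' hMP' fun ℓ hℓ _ ↦ (hP' ℓ hℓ).one_le
  have hsupp : ∀ z : ZMod M, ∑ χ ∈ Xf, χ z ≠ 0 → z ^ r = 1 := by
    intro z hz
    obtain ⟨hzu, hzr⟩ := isUnit_and_pow_eq_one_of_sum_galoisCoset_ne_zero ψ r hz
    exact pow_eq_one_of_apply_pow_eq_one hprim hr2 hrℓ hzu hzr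
  obtain ⟨χ', hχ', hne⟩ := hM₀ M hM.le hMP' Xf (ψ (-1)) (galoisCoset_nonempty ψ r) hX hR hsupp
  -- `χ'⁻¹ = (ψ⁻¹)^{1 + rj}` is an admissible conjugate of `ψ⁻¹`, so its symbol sum vanishes
  obtain ⟨j, rfl⟩ := hmem' χ' hχ'
  rw [← inv_pow] at hne
  exact hne (twistedSymbolSum_pow_eq_zero_of_modEq_one_step hf hMP' hS (hodd j) hrP hr1 (hmodr j))

omit [NeZero N] in
/-- A coefficient bound `|aₙ| ≤ C n^θ` with `0 < θ ≤ θ₁` gives `|aₙ| ≤ C n^{θ₁}`. [folklore] -/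
theorem norm_cuspCoeff_le_of_le {C θ θ₁ : ℝ} (hC : 0 ≤ C) (hθ : 0 < θ) (hθ₁ : θ ≤ θ₁)
    (ha : ∀ n : ℕ, ‖cuspCoeff f n‖ ≤ C * (n : ℝ) ^ θ) (n : ℕ) :
    ‖cuspCoeff f n‖ ≤ C * (n : ℝ) ^ θ₁ := by
  rcases Nat.eq_zero_or_pos n with rfl | hn
  · have h := ha 0
    rw [Nat.cast_zero, Real.zero_rpow hθ.ne'] at h
    rw [Nat.cast_zero, Real.zero_rpow (by linarith : θ₁ ≠ 0)]
    exact h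
  · refine (ha n).trans (mul_le_mul_of_nonneg_left ?_ hC)
    exact Real.rpow_le_rpow_of_exponent_le (by exact_mod_cast hn) hθ₁

/-- **Rohrlich's non-vanishing theorem for an arbitrary newform and an arbitrary finite set of
primes, conditional only on a coefficient bound** (Rohrlich 1984, Theorem, p. 409, case `ψ = 1`).
Let `f ∈ S₂(Γ₀(N))` be a normalised newform with `|aₙ(f)| ≤ C n^θ` for some `θ < 2/3` and `P` a
finite set of natural numbers none of which divides `N`. Then only finitely many primitive
Dirichlet characters `χ` of conductor `M ≥ 1` divisible only by primes in `P` have `L(f, χ, 1) = 0`.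
Proof (Rohrlich's, for composite conductors): an exceptional primitive `ψ` mod `M` has
`∑_a ψ̄(a){∞, a/M}_f = 0` (Birch, `twisted_LValue_eq_holds`), hence so do all
`(ψ̄)^{1 + rj}` with `r = ∏_{q ∈ P} q^{v_q([K_f:ℚ]!) + 2} ∏_{q ∈ P} (q - 1)`
(`twistedSymbolSum_pow_eq_zero_of_modEq_one_step`); these are the inverses of the members of the
family `ψ⟨ψ^r⟩`, primitive (`isPrimitive_pow_of_coprime_orderOf`, `coprime_totient_of_modEq_one_step`)
of the parity of `ψ`, whose character sum is supported on `≤ 4 r ∏_{q ∈ P} q` classes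
(`card_filter_apply_pow_eq_one_le`) inside `{z : z^r = 1}` (`pow_eq_one_of_apply_pow_eq_one`);
for `M ≥ M₀(f, P)` this contradicts `exists_forall_family_exists_twistedSymbolSum_ne_zero_mod`.
[cite: RohrlichInventiones1984, Theorem (p. 409)] -/
theorem Rohrlich1984_of_coeffBound (hf : IsNewform0 f)
    {C θ : ℝ} (hC : 0 ≤ C) (hθ : 0 < θ) (hθ1 : θ < 2 / 3)
    (ha : ∀ n : ℕ, ‖cuspCoeff f n‖ ≤ C * (n : ℝ) ^ θ) (P : Finset ℕ) (hPN : ∀ q ∈ P, ¬ q ∣ N) :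
    Set.Finite {χ : Σ m : ℕ, DirichletCharacter ℂ m |
      χ.1 ≠ 0 ∧ χ.1.primeFactors ⊆ P ∧ χ.2.IsPrimitive ∧
        ∃ L : ℂ → ℂ, Differentiable ℂ L ∧
          (∀ s : ℂ, 2 < s.re → L s = twistedLSeries f χ.2 s) ∧ L 1 = 0} := by
  have hP' : ∀ q ∈ P.filter Nat.Prime, q.Prime := fun q hq ↦ (Finset.mem_filter.mp hq).2
  have hP'N : ∀ q ∈ P.filter Nat.Prime, ¬ q ∣ N := fun q hq ↦ hPN q (Finset.mem_filter.mp hq).1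
  -- the inputs of the family theorem for the Fricke pair `(f, w_N f)`
  have hW : IsFrickePair N f (frickeInvolution N 2 f) := isFrickePair_frickeInvolution N f
  have h1 : cuspCoeff f 1 = 1 := (isNormalized_iff_cuspCoeff_one f).mp hf.2.2
  obtain ⟨C', hC', hb⟩ := exists_norm_cuspCoeff_le_mul (frickeInvolution N 2 f)
  have hb' : ∀ n : ℕ, ‖cuspCoeff (frickeInvolution N 2 f) n‖ ≤ C' * (n : ℝ) ^ (1 : ℝ) :=
    fun n ↦ by simpa only [Real.rpow_one] using hb n
  exact finite_exceptional_of_forall_family hf P fun R₁ L hL ↦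
    exists_forall_family_exists_twistedSymbolSum_ne_zero_mod f hW hP' hP'N hC hθ hθ1 hC'.le one_pos
      le_rfl ha hb' h1 R₁ hL

/-- **Rohrlich's non-vanishing theorem for an arbitrary newform and an arbitrary finite set of
primes, given any power-saving coefficient bound** (Rohrlich 1984, Theorem, p. 409, case `ψ = 1`):
as `Rohrlich1984_of_coeffBound`, but `|aₙ(f)| ≤ C n^θ` is only required for some `θ < 1` — e.g.
the classical estimates of Kloosterman (1927), Rankin (1939) or Selberg for weight `2`, short of the
Ramanujan–Petersson bound — the dual term being estimated by Rankin's mean square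
(`exists_forall_family_exists_twistedSymbolSum_ne_zero_mod'`). [cite: RohrlichInventiones1984, Theorem (p. 409)] -/
theorem Rohrlich1984_of_coeffBound' (hf : IsNewform0 f)
    {C θ : ℝ} (hC : 0 ≤ C) (hθ : 0 < θ) (hθ1 : θ < 1)
    (ha : ∀ n : ℕ, ‖cuspCoeff f n‖ ≤ C * (n : ℝ) ^ θ) (P : Finset ℕ) (hPN : ∀ q ∈ P, ¬ q ∣ N) :
    Set.Finite {χ : Σ m : ℕ, DirichletCharacter ℂ m |
      χ.1 ≠ 0 ∧ χ.1.primeFactors ⊆ P ∧ χ.2.IsPrimitive ∧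
        ∃ L : ℂ → ℂ, Differentiable ℂ L ∧
          (∀ s : ℂ, 2 < s.re → L s = twistedLSeries f χ.2 s) ∧ L 1 = 0} := by
  have hP' : ∀ q ∈ P.filter Nat.Prime, q.Prime := fun q hq ↦ (Finset.mem_filter.mp hq).2
  have hP'N : ∀ q ∈ P.filter Nat.Prime, ¬ q ∣ N := fun q hq ↦ hPN q (Finset.mem_filter.mp hq).1
  have hW : IsFrickePair N f (frickeInvolution N 2 f) := isFrickePair_frickeInvolution N f
  have h1 : cuspCoeff f 1 = 1 := (isNormalized_iff_cuspCoeff_one f).mp hf.2.2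
  have ha₁ := norm_cuspCoeff_le_of_le (f := f) hC hθ (le_max_left θ (3 / 4)) ha
  exact finite_exceptional_of_forall_family hf P fun R₁ L hL ↦
    exists_forall_family_exists_twistedSymbolSum_ne_zero_mod' f hW hP' hP'N hC (le_max_right _ _)
      (max_lt hθ1 (by norm_num)) ha₁ h1 R₁ hL

/-- **Rohrlich's theorem from the Ramanujan–Petersson bound, one newform at a time.** For a
normalised newform `f ∈ S₂(Γ₀(N))` satisfying `|aₙ(f)| ≤ d(n) √n` for all `n` (Eichler–Shimura–Igusa
/ Deligne 1974, Thm. 8.2, with `|a_p| ≤ 1` at `p ∣ N`; not in the tree) the conclusion of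
`Rohrlich1984_nonvanishing_twists` holds for `f` and every finite `P` with `q ∤ N` (`q ∈ P`): by the
divisor bound `d(n) ≤ C n^{1/12}` (`exists_card_divisors_le_mul_rpow'`, Hardy–Wright Thm. 315),
`|aₙ| ≤ C n^{7/12}` and `Rohrlich1984_of_coeffBound` applies. [cite: RohrlichInventiones1984, Theorem (p. 409)] -/
theorem Rohrlich1984_of_ramanujanPetersson (hf : IsNewform0 f)
    (hRP : ∀ n : ℕ, ‖cuspCoeff f n‖ ≤ (Nat.divisors n).card * Real.sqrt n)
    (P : Finset ℕ) (hPN : ∀ q ∈ P, ¬ q ∣ N) :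
    Set.Finite {χ : Σ m : ℕ, DirichletCharacter ℂ m |
      χ.1 ≠ 0 ∧ χ.1.primeFactors ⊆ P ∧ χ.2.IsPrimitive ∧
        ∃ L : ℂ → ℂ, Differentiable ℂ L ∧
          (∀ s : ℂ, 2 < s.re → L s = twistedLSeries f χ.2 s) ∧ L 1 = 0} := by
  obtain ⟨C, hC1, hC⟩ := Literature.NumberTheory.Sieve.exists_card_divisors_le_mul_rpow'
    (by norm_num : (0 : ℝ) < 1 / 12)
  refine Rohrlich1984_of_coeffBound hf (C := C) (θ := 7 / 12) (by linarith) (by norm_num)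
    (by norm_num) (fun n ↦ ?_) P hPN
  calc ‖cuspCoeff f n‖ ≤ (Nat.divisors n).card * Real.sqrt n := hRP n
    _ ≤ (C * (n : ℝ) ^ (1 / 12 : ℝ)) * (n : ℝ) ^ (1 / 2 : ℝ) := by
        rw [Real.sqrt_eq_rpow]
        exact mul_le_mul_of_nonneg_right (hC n) (by positivity)
    _ = C * (n : ℝ) ^ (7 / 12 : ℝ) := by
        rw [mul_assoc, ← Real.rpow_add' (Nat.cast_nonneg _) (by norm_num)]
        norm_num

/-- **`Rohrlich1984_nonvanishing_twists` follows from the Ramanujan–Petersson bound for weight-`2`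
newforms** — the only input of Rohrlich's proof that the tree does not have: if every normalised
newform `f ∈ S₂(Γ₀(N))` satisfies `|aₙ(f)| ≤ d(n) √n` (Eichler 1954, Shimura 1958, Igusa 1959;
Deligne 1974, Thm. 8.2), then the named fact holds in full (every newform, every level, every finite
`P`). [cite: RohrlichInventiones1984, Theorem (p. 409)] -/
theorem Rohrlich1984_nonvanishing_twists_of_ramanujanPetersson
    (hRP : ∀ {N : ℕ} [NeZero N] {f : CuspForm (CongruenceSubgroup.Gamma0 N) 2}, IsNewform0 f →
      ∀ n : ℕ, ‖cuspCoeff f n‖ ≤ (Nat.divisors n).card * Real.sqrt n) :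
    Rohrlich1984_nonvanishing_twists :=
  fun hf P hP ↦ Rohrlich1984_of_ramanujanPetersson hf (hRP hf) P hP

/-- **`Rohrlich1984_nonvanishing_twists` follows from any coefficient bound `|aₙ(f)| ≤ C_f n^{θ_f}`,
`θ_f < 2/3`, for normalised weight-`2` newforms** (the form in which the analytic argument consumes
the Ramanujan–Petersson estimate). [cite: RohrlichInventiones1984, Theorem (p. 409)] -/
theorem Rohrlich1984_nonvanishing_twists_of_coeffBound
    (hcb : ∀ {N : ℕ} [NeZero N] {f : CuspForm (CongruenceSubgroup.Gamma0 N) 2}, IsNewform0 f →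
      ∃ C θ : ℝ, 0 ≤ C ∧ 0 < θ ∧ θ < 2 / 3 ∧ ∀ n : ℕ, ‖cuspCoeff f n‖ ≤ C * (n : ℝ) ^ θ) :
    Rohrlich1984_nonvanishing_twists := by
  intro N _ f hf P hP
  obtain ⟨C, θ, hC, hθ, hθ1, ha⟩ := hcb hf
  exact Rohrlich1984_of_coeffBound hf hC hθ hθ1 ha P hP

/-- **Rohrlich's theorem for elliptic curves over `ℚ`, every finite set of primes `P`** — the title
application of Rohrlich 1984 (Theorem, p. 409, for the newform of a modular elliptic curve),
unconditionally: for `E = W/ℚ` elliptic, `f ∈ S₂(Γ₀(N))` its newform (`IsNewformOf W f`) and `P` a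
finite set of natural numbers none dividing `N`, only finitely many primitive Dirichlet characters
`χ` unramified outside `P` and infinity have `L(E, χ, 1) = L(f, χ, 1) = 0`. The coefficient bound is
Hasse's (`WeierstrassCurve.norm_LFunction_le_rpow`: `|aₙ(E)| ≤ 16^{256} n^{5/8}`).
[cite: RohrlichInventiones1984, Theorem (p. 409)] -/
theorem Rohrlich1984_of_isNewformOf {W : WeierstrassCurve ℚ} [W.IsElliptic]
    (hfW : IsNewformOf W f) (P : Finset ℕ) (hPN : ∀ q ∈ P, ¬ q ∣ N) :
    Set.Finite {χ : Σ m : ℕ, DirichletCharacter ℂ m |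
      χ.1 ≠ 0 ∧ χ.1.primeFactors ⊆ P ∧ χ.2.IsPrimitive ∧
        ∃ L : ℂ → ℂ, Differentiable ℂ L ∧
          (∀ s : ℂ, 2 < s.re → L s = twistedLSeries f χ.2 s) ∧ L 1 = 0} :=
  Rohrlich1984_of_coeffBound hfW.1 (C := (16 : ℝ) ^ 256) (θ := 5 / 8) (by positivity) (by norm_num)
    (by norm_num) (fun n ↦ by rw [hfW.2 n]; exact W.norm_LFunction_le_rpow n) P hPN

/-- **`Rohrlich1984_nonvanishing_twists` follows from any power-saving coefficient bound
`|aₙ(f)| ≤ C_f n^{θ_f}`, `θ_f < 1`, for normalised weight-`2` newforms on `Γ₀(N)`** — the minimal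
pointwise input of the first-moment method (needed at the sparse integers of the support of the
family sum); the Ramanujan–Petersson bound (`Rohrlich1984_nonvanishing_twists_of_ramanujanPetersson`)
is the case `θ = 1/2 + ε`. [cite: RohrlichInventiones1984, Theorem (p. 409)] -/
theorem Rohrlich1984_nonvanishing_twists_of_coeffBound'
    (hcb : ∀ {N : ℕ} [NeZero N] {f : CuspForm (CongruenceSubgroup.Gamma0 N) 2}, IsNewform0 f →
      ∃ C θ : ℝ, 0 ≤ C ∧ 0 < θ ∧ θ < 1 ∧ ∀ n : ℕ, ‖cuspCoeff f n‖ ≤ C * (n : ℝ) ^ θ) :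
    Rohrlich1984_nonvanishing_twists := by
  intro N _ f hf P hP
  obtain ⟨C, θ, hC, hθ, hθ1, ha⟩ := hcb hf
  exact Rohrlich1984_of_coeffBound' hf hC hθ hθ1 ha P hP

end MainComposite

end Literature.NumberTheory.EllipticCurves
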